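import Literature.MathematicalPhysics.QuantumLattice.NagaokaTasaki
import Literature.MathematicalPhysics.QuantumLattice.HubbardLiebBasis
import HarnessLib

/-!
# The Nagaoka–Tasaki theorem: proof (and the sign of the hopping amplitude)

Companion to `NagaokaTasaki.lean` (vocabulary: `hubbardInfty`, `IsGutzwillerGroundState`,
`gutzwillerGroundSpace`, `OneHoleConfig`, `IsHoleHop`, `holeHopGraph`, `SatisfiesConnectivity`). The
Nagaoka–Tasaki statement originally vendored there as a named fact (cite item `wi-03677`, hypothesis
`0 < t`) is mis-stated; it is referred to below as "the original statement" and is spelled out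
verbatim exactly once in this file, as the proposition negated by `not_nagaoka_tasaki`.

## The sign discrepancy in the original statement

The original statement assumes `0 < t` for the tree's Hamiltonian `hamiltonian G t 0 = -t Σ_{x∼y,σ} c†_{xσ}
c_{yσ}` and its docstring glosses this as "Tasaki's `t_{xy} = t ≥ 0`". But Tasaki writes the
hopping term WITHOUT a minus sign, `H_hop = Σ_{x,y,σ} t_{xy} c†_{xσ} c_{yσ}` (Tasaki 1998, eq. (2.2) and
its footnote: "the standard convention is to put a minus sign in front … and to assume
`t_{xy} ≥ 0`"), and Nagaoka's theorem (Tasaki 1989, Theorem; Tasaki 1998, Theorem 6.3) assumes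
`t_{xy} ≥ 0` in THAT convention — "this sign of `t_{xy}` is opposite from the standard choice; in
bipartite systems one can change the sign by a gauge transformation" (footnote to Theorem 6.3).
Hence Tasaki's `t_{xy}` is the tree's `-t`, and the theorem requires `t ≤ 0` here (`t < 0` for the
bonds of `G` to carry hopping at all). For `t > 0` the statement is false on non-bipartite graphs:
on the triangle `K₃` (which satisfies the connectivity condition) with `N = 2` and `t = 1`, exact
diagonalisation of `hubbardInfty` on the 12-dimensional projected sector gives the spectrum
`{-2, -1 (×6), 1 (×2), 2 (×3)}`; the unique ground state is a spin SINGLET (`S² ψ = 0 ≠ 2ψ`) and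
the ground space is one-dimensional (not `N + 1 = 3`). With `t = -1` the ground energy `-2|t|`
has multiplicity `3 = N + 1`, all with `S² = 2 = S(S+1)`, `S = 1`.

This file therefore vendors the corrected statement `nagaoka_tasaki_neg` — verbatim the original
statement with `0 < t` replaced by `t < 0` — and PROVES it (`nagaoka_tasaki_neg_holds`), and it
REFUTES the original: `not_nagaoka_tasaki` (last section; its type is the negation of the original
statement, written out in full), by the triangle. There `SatisfiesConnectivity ⊤` on `Fin 3` is
checked by `decide`; the Schur bound `Re⟨ψ,Hψ⟩ ≥ -(|Λ|-1)‖ψ‖²` on the complete graph and the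
explicit singlet
`NagaokaTasaki.singlet` (the alternating vector on the 6-cycle that the `S^z = 0` sector of the
hole-hop graph forms, amplitude `gauge × sign` of the permutation `(hole, ↑-site, ↓-site)`) give the
projected ground energy `-2` at `t = 1` with the singlet as a ground state, and
`(S² singlet)(E₁) = 0 ≠ 2 · singlet(E₁)`.

## The proof (Tasaki 1989; Tasaki 1998, §6.3 — "the Perron–Frobenius argument")

All auxiliary material is in the sub-namespace `…QuantumLattice.NagaokaTasaki`.

* **P0** matrix elements of `c_i`, `c†_i`, `c†_a c_b`, `n_{xσ}` and of `hamiltonian G t 0`,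
  `gutzwillerProj`, `hubbardInfty G t` on occupation-basis amplitudes.
* **P3** one-hole configurations: the hole (`holes`, `IsOneHole`), the spin at a site (`spinAt`),
  moving an electron into the hole (`move`), `IsHoleHop ↔ move along an edge` (`isHoleHop_iff`),
  reversibility; the Jordan–Wigner sign of a hop is `-(gauge s)(gauge s')` with
  `gauge s = (-1)^{#electrons left of the hole}` (`jwSign_hop`), so that in the gauged basis
  `(Hψ)(s) = t·gauge(s)·Σ_{y∼hole} gauge(s_y) ψ(s_y)` (`hubbardInfty_mulVec_of_holes_eq`): the hole
  hops with amplitude `+t` — for `t < 0`, `-H` is a non-negative matrix.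
* **P1** a Perron vector for the connected graph `G`: `λ > 0`, `g > 0`, `A g = λ g`, built
  variationally (maximise the adjacency form on the unit sphere, take absolute values, polarise;
  positivity by connectivity) — `exists_pos_adj_eigenvector`.
* **P2** the ground-state transformation: for `B ≥ 0` symmetric and `g > 0` with `Bg ≤ λg`,
  `Re⟨f,Bf⟩ ≤ λ‖f‖²`, with equality only if `f/g` is constant across the edges of `B`
  (`re_quadratic_le_of_subeigenvector`; the identity `Σ B g g' (u-u')² ≥ 0`).
* **P4** spin: `S^±`, `S^z` on no-double-occupancy amplitudes carry no fermionic sign; the states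
  `Φ_{c,k}` (amplitude `gauge(s)·c(hole)` on one-hole configurations with `k` down spins — the
  multiplet `(S⁻)^k Φ_↑`) satisfy `S⁻Φ_k = (k+1)Φ_{k+1}`, `S⁺Φ_{k+1} = (N-k)Φ_k`, `S^zΦ_k = ½(N-2k)Φ_k`,
  hence `S²Φ_k = (N/2)(N/2+1)Φ_k` (`spinSq_mulVec_dicke`).
* **P5** assembly (`nagaoka_tasaki_of_neg`): with `c = g` the Perron vector, `HΦ_k = tλΦ_k`
  (`hubbardInfty_mulVec_dicke`); `Re⟨ψ,Hψ⟩ ≥ tλ‖ψ‖²` on the projected sector (P2 with the lifted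
  weight `g(hole)`), so the projected ground energy is `tλ`; an eigenvector with eigenvalue `tλ`
  has `gauge·ψ ∝ g(hole)` along hole hops (equality case), hence — by the connectivity condition —
  on each `S^z` sector, i.e. `ψ ∈ span{Φ_0,…,Φ_N}`; so (i) `S²ψ = S(S+1)ψ`, and (ii) the ground
  space is `span{Φ_0,…,Φ_N}`, of dimension `N + 1` (disjoint supports).

## Sources

* H. Tasaki, *Extension of Nagaoka's theorem on the large-U Hubbard model*, Phys. Rev. B **40**
  (1989) 9192–9193: the Theorem and the connectivity condition. [cite: Tasaki1989, Theorem]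
* H. Tasaki, *The Hubbard model — an introduction and selected rigorous results*, J. Phys. Cond.
  Mat. **10** (1998) 4353 = arXiv:cond-mat/9512169: eq. (2.2) with its footnote (sign convention of
  `H_hop`), §6.3 Theorem 6.3 with its footnote (`t_{xy} ≥ 0`, "opposite from the standard
  choice"). [cite: Tasaki1998, Theorem 6.3]
* Y. Nagaoka, Phys. Rev. **147** (1966) 392, §3 (the original theorem).
-/

noncomputable section

open Matrix Finset

namespace Literature.MathematicalPhysics.QuantumLattice

/-! The auxiliary development lives in the sub-namespace
`Literature.MathematicalPhysics.QuantumLattice.NagaokaTasaki`; only the corrected named fact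
`nagaoka_tasaki_neg` and its discharge are declared directly in
`Literature.MathematicalPhysics.QuantumLattice`. -/

namespace NagaokaTasaki

/-! ### P0. Action of the Jordan–Wigner operators on occupation-basis amplitudes

The matrix elements of `c_i`, `c†_i`, `c†_a c_b` and `n_{xσ}` on amplitudes are taken from the tree
(`LiebThm1.LiebThm1.creation_mul_annihilation_mulVec_apply` in `HubbardWave0LiebProofs`,
`LiebTwo.numberOp_mulVec` in `HubbardLiebBasis`, `jwSign_mul_self`/`star_jwSign` in
`FermionOperatorsProofs`, `orb_inj` in `HubbardLiebConfig`). -/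

/-! ### P0'. The `U = ∞` Hubbard Hamiltonian on amplitudes -/

section Hubbard

variable {Λ : Type*} [LinearOrder Λ] [Fintype Λ]
variable (G : SimpleGraph Λ) [DecidableRel G.Adj]

/-- The pure hopping Hamiltonian acting on an amplitude, term by term. [folklore] -/
theorem hamiltonian_zero_mulVec_apply (t : ℝ) (ψ : Fock (Orb Λ)) (s : Finset (Orb Λ)) :
    (hamiltonian G t 0 *ᵥ ψ) s =
      -(t : ℂ) * ∑ x : Λ, ∑ y : Λ, ∑ σ : Fin 2,
        if G.Adj x y then ((creation (orb x σ) * annihilation (orb y σ)) *ᵥ ψ) s else 0 := by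
  simp only [hamiltonian, Complex.ofReal_zero, zero_smul, add_zero, smul_mulVec,
    Pi.smul_apply, smul_eq_mul, sum_mulVec, Finset.sum_apply]
  congr 1
  refine Finset.sum_congr rfl fun x _ => Finset.sum_congr rfl fun y _ =>
    Finset.sum_congr rfl fun σ _ => ?_
  split_ifs <;> simp

/-- The Gutzwiller projector kills exactly the doubly occupied configurations. [folklore] -/
theorem gutzwillerProj_mulVec_apply (ψ : Fock (Orb Λ)) (s : Finset (Orb Λ)) :
    (gutzwillerProj *ᵥ ψ) s = if HasDoubleOccupancy s then 0 else ψ s := by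
  simp only [gutzwillerProj, mulVec_diagonal]
  split_ifs <;> simp

/-- On a Gutzwiller vector the projected Hamiltonian is the hopping term followed by the projection. [folklore] -/
theorem hubbardInfty_mulVec_apply (t : ℝ) {ψ : Fock (Orb Λ)} (hψ : IsGutzwiller ψ)
    (s : Finset (Orb Λ)) :
    (hubbardInfty G t *ᵥ ψ) s =
      if HasDoubleOccupancy s then 0 else (hamiltonian G t 0 *ᵥ ψ) s := by
  rw [hubbardInfty, ← mulVec_mulVec, ← mulVec_mulVec, (gutzwillerProj_mulVec_eq_self_iff ψ).2 hψ,
    gutzwillerProj_mulVec_apply]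

end Hubbard

/-! ### P3a. Combinatorics of one-hole configurations -/

section Configs

variable {Λ : Type*} [LinearOrder Λ] [Fintype Λ]

/-- The site of an orbital `(x, σ)`. [folklore] -/
def site (o : Orb Λ) : Λ := (ofLex o).1

omit [LinearOrder Λ] [Fintype Λ] in
/-- The site of `orb x σ` is `x`. [folklore] -/
@[simp] theorem site_orb (x : Λ) (σ : Fin 2) : site (orb x σ) = x := rfl

omit [LinearOrder Λ] [Fintype Λ] in
/-- An orbital is `orb` of its site and its spin. [folklore] -/
theorem orb_site (o : Orb Λ) : orb (site o) (ofLex o).2 = o := rfl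

omit [LinearOrder Λ] [Fintype Λ] in
/-- Every orbital is an up or a down orbital at its site. [folklore] -/
theorem eq_orb_zero_or_one (o : Orb Λ) : o = orb (site o) 0 ∨ o = orb (site o) 1 := by
  have h := orb_site o
  generalize (ofLex o).2 = σ at h
  fin_cases σ
  · exact Or.inl h.symm
  · exact Or.inr h.symm

omit [LinearOrder Λ] [Fintype Λ] in
/-- Without double occupancy, distinct occupied orbitals sit at distinct sites. [folklore] -/
theorem site_injOn {s : Finset (Orb Λ)} (hs : ¬ HasDoubleOccupancy s) :
    Set.InjOn site (s : Set (Orb Λ)) := by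
  intro o ho o' ho' h
  simp only [Finset.mem_coe] at ho ho'
  rcases eq_orb_zero_or_one o with e | e <;> rcases eq_orb_zero_or_one o' with e' | e'
  · rw [e, e', h]
  · exact absurd ⟨site o', by rw [← h, ← e]; exact ho, by rw [← e']; exact ho'⟩ hs
  · exact absurd ⟨site o', by rw [← e']; exact ho', by rw [← h, ← e]; exact ho⟩ hs
  · rw [e, e', h]

/-- The empty sites (holes) of a configuration. [folklore] -/
def holes (s : Finset (Orb Λ)) : Finset Λ := univ.filter fun x => orb x 0 ∉ s ∧ orb x 1 ∉ s

/-- Membership in `holes`. [folklore] -/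
theorem mem_holes {s : Finset (Orb Λ)} {x : Λ} : x ∈ holes s ↔ orb x 0 ∉ s ∧ orb x 1 ∉ s := by
  simp [holes]

/-- The occupied sites are the complement of the holes. [folklore] -/
theorem image_site_eq_compl_holes (s : Finset (Orb Λ)) : s.image site = (holes s)ᶜ := by
  ext x
  simp only [mem_image, mem_compl, mem_holes, not_and_or, not_not]
  constructor
  · rintro ⟨o, ho, rfl⟩
    rcases eq_orb_zero_or_one o with e | e
    · rw [e] at ho; exact Or.inl ho
    · rw [e] at ho; exact Or.inr ho
  · rintro (h | h)
    · exact ⟨_, h, rfl⟩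
    · exact ⟨_, h, rfl⟩

/-- One-hole configurations as a predicate: `|Λ| - 1` electrons, no double occupancy (the carrier of
`OneHoleConfig Λ`). [cite: Tasaki1989, Theorem] -/
def IsOneHole (s : Finset (Orb Λ)) : Prop := s.card = Fintype.card Λ - 1 ∧ ¬ HasDoubleOccupancy s

/-- Being a one-hole configuration is decidable. [folklore] -/
instance : DecidablePred (IsOneHole (Λ := Λ)) := fun s => by
  unfold IsOneHole; infer_instance

/-- A one-hole configuration on a nonempty lattice has exactly one hole (counting sites: no double occupancy makes the site map injective). [folklore] -/
theorem IsOneHole.card_holes {s : Finset (Orb Λ)} (hs : IsOneHole s) (hΛ : 0 < Fintype.card Λ) :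
    (holes s).card = 1 := by
  have h1 : (s.image site).card = s.card := Finset.card_image_of_injOn (site_injOn hs.2)
  rw [image_site_eq_compl_holes, Finset.card_compl, hs.1] at h1
  have := Finset.card_le_univ (holes s)
  omega

/-- The hole of a one-hole configuration. [folklore] -/
theorem IsOneHole.exists_holes_eq {s : Finset (Orb Λ)} (hs : IsOneHole s)
    (hΛ : 0 < Fintype.card Λ) : ∃ h, holes s = {h} :=
  Finset.card_eq_one.1 (hs.card_holes hΛ)

/-- The spin carried at site `x` (junk value `1` at an empty site). [folklore] -/
def spinAt (s : Finset (Orb Λ)) (x : Λ) : Fin 2 := if orb x 0 ∈ s then 0 else 1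

/-- The hole is empty. [folklore] -/
theorem not_mem_of_holes_eq {s : Finset (Orb Λ)} {h : Λ} (hh : holes s = {h}) (σ : Fin 2) :
    orb h σ ∉ s := by
  have : h ∈ holes s := by rw [hh]; exact mem_singleton_self h
  rw [mem_holes] at this
  fin_cases σ
  · exact this.1
  · exact this.2

/-- Every site other than the hole is occupied, by the spin `spinAt s x`. [folklore] -/
theorem orb_spinAt_mem {s : Finset (Orb Λ)} {h x : Λ} (hh : holes s = {h}) (hx : x ≠ h) :
    orb x (spinAt s x) ∈ s := by
  have : x ∉ holes s := by rw [hh, mem_singleton]; exact hx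
  rw [mem_holes, not_and_or, not_not, not_not] at this
  unfold spinAt
  split_ifs with h0
  · exact h0
  · exact this.resolve_left h0

omit [Fintype Λ] in
/-- Without double occupancy an occupied site carries exactly the spin `spinAt s x`. [folklore] -/
theorem eq_spinAt_of_mem {s : Finset (Orb Λ)} (hs : ¬ HasDoubleOccupancy s) {x : Λ} {σ : Fin 2}
    (hx : orb x σ ∈ s) : σ = spinAt s x := by
  unfold spinAt
  split_ifs with h0
  · fin_cases σ
    · rfl
    · exact absurd ⟨x, h0, hx⟩ hs
  · fin_cases σ
    · exact absurd hx h0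
    · rfl

/-- Occupied sites are not the hole. [folklore] -/
theorem ne_of_mem_of_holes_eq {s : Finset (Orb Λ)} {h x : Λ} {σ : Fin 2} (hh : holes s = {h})
    (hx : orb x σ ∈ s) : x ≠ h := by
  rintro rfl
  exact not_mem_of_holes_eq hh σ hx

/-- Membership in a configuration with a single hole `h` and no double occupancy. [folklore] -/
theorem orb_mem_iff {s : Finset (Orb Λ)} (hs : ¬ HasDoubleOccupancy s) {h : Λ} (hh : holes s = {h})
    {x : Λ} {σ : Fin 2} : orb x σ ∈ s ↔ x ≠ h ∧ σ = spinAt s x := by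
  constructor
  · exact fun hx => ⟨ne_of_mem_of_holes_eq hh hx, eq_spinAt_of_mem hs hx⟩
  · rintro ⟨hx, rfl⟩
    exact orb_spinAt_mem hh hx

/-- The number of down spins of a configuration. [folklore] -/
def downCount (s : Finset (Orb Λ)) : ℕ := (univ.filter fun x : Λ => orb x 1 ∈ s).card

/-- Without double occupancy, `N↑ + N↓` is the number of electrons. [folklore] -/
theorem upCount_add_downCount {s : Finset (Orb Λ)} (hs : ¬ HasDoubleOccupancy s) :
    upCount s + downCount s = s.card := by
  rw [upCount, downCount, ← Finset.card_union_of_disjoint]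
  · rw [← Finset.card_image_of_injOn (site_injOn hs)]
    congr 1
    ext x
    simp only [mem_union, mem_filter, mem_univ, true_and, mem_image]
    constructor
    · rintro (h | h)
      · exact ⟨_, h, rfl⟩
      · exact ⟨_, h, rfl⟩
    · rintro ⟨o, ho, rfl⟩
      rcases eq_orb_zero_or_one o with e | e
      · rw [e] at ho; exact Or.inl ho
      · rw [e] at ho; exact Or.inr ho
  · rw [Finset.disjoint_filter]
    intro x _ h0 h1
    exact hs ⟨x, h0, h1⟩

/-- A one-hole configuration has at most `|Λ| - 1` down spins. [folklore] -/
theorem downCount_le {s : Finset (Orb Λ)} (hs : IsOneHole s) : downCount s ≤ Fintype.card Λ - 1 := by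
  have := upCount_add_downCount hs.2
  rw [hs.1] at this
  omega

end Configs

/-! ### P3b. Moving the hole -/

section Move

variable {Λ : Type*} [LinearOrder Λ] [Fintype Λ]

/-- `move s x h`: the electron at site `x` hops (with its spin) to the site `h`. [cite: Tasaki1989, Theorem] -/
def move (s : Finset (Orb Λ)) (x h : Λ) : Finset (Orb Λ) :=
  insert (orb h (spinAt s x)) (s.erase (orb x (spinAt s x)))

variable {s : Finset (Orb Λ)} {h x : Λ}

/-- Membership in the moved configuration, site by site. [folklore] -/
theorem orb_mem_move_iff (hs : ¬ HasDoubleOccupancy s) (hh : holes s = {h}) (hx : x ≠ h)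
    {z : Λ} {τ : Fin 2} :
    orb z τ ∈ move s x h ↔ (z = h ∧ τ = spinAt s x) ∨ (z ≠ x ∧ z ≠ h ∧ τ = spinAt s z) := by
  rw [move, mem_insert, mem_erase, orb_inj, orb_mem_iff hs hh]
  have hne_iff : orb z τ ≠ orb x (spinAt s x) ↔ ¬ (z = x ∧ τ = spinAt s x) := by
    rw [Ne, orb_inj]
  rw [hne_iff]
  constructor
  · rintro (⟨rfl, rfl⟩ | ⟨hne, hzh, rfl⟩)
    · exact Or.inl ⟨rfl, rfl⟩
    · exact Or.inr ⟨fun hzx => hne ⟨hzx, by rw [hzx]⟩, hzh, rfl⟩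
  · rintro (⟨rfl, rfl⟩ | ⟨hzx, hzh, rfl⟩)
    · exact Or.inl ⟨rfl, rfl⟩
    · exact Or.inr ⟨fun h' => hzx h'.1, hzh, rfl⟩

/-- Moving an electron into the hole creates no double occupancy. [folklore] -/
theorem not_hasDoubleOccupancy_move (hs : ¬ HasDoubleOccupancy s) (hh : holes s = {h})
    (hx : x ≠ h) : ¬ HasDoubleOccupancy (move s x h) := by
  rintro ⟨z, h0, h1⟩
  rw [orb_mem_move_iff hs hh hx] at h0 h1
  rcases h0 with ⟨hzh, e0⟩ | ⟨-, hzh, e0⟩ <;> rcases h1 with ⟨hzh', e1⟩ | ⟨-, hzh', e1⟩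
  · exact absurd (e0.trans e1.symm) (by decide)
  · exact hzh' hzh
  · exact hzh hzh'
  · exact absurd (e0.trans e1.symm) (by decide)

/-- Moving an electron into the hole preserves the electron number. [folklore] -/
theorem card_move (hh : holes s = {h}) (hx : x ≠ h) :
    (move s x h).card = s.card := by
  have hmem : orb x (spinAt s x) ∈ s := orb_spinAt_mem hh hx
  have hnot : orb h (spinAt s x) ∉ s.erase (orb x (spinAt s x)) := fun h' =>
    not_mem_of_holes_eq hh _ (Finset.mem_of_mem_erase h')
  rw [move, Finset.card_insert_of_notMem hnot, Finset.card_erase_of_mem hmem]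
  have : 0 < s.card := Finset.card_pos.2 ⟨_, hmem⟩
  omega

/-- After the move the vacated site is the new hole. [folklore] -/
theorem holes_move (hs : ¬ HasDoubleOccupancy s) (hh : holes s = {h}) (hx : x ≠ h) :
    holes (move s x h) = {x} := by
  ext z
  simp only [mem_holes, orb_mem_move_iff hs hh hx, mem_singleton]
  constructor
  · rintro ⟨h0, h1⟩
    by_contra hzx
    by_cases hzh : z = h
    · subst hzh
      have : spinAt s x = 0 ∨ spinAt s x = 1 := by
        unfold spinAt; split_ifs <;> simp
      rcases this with e | e
      · exact h0 (Or.inl ⟨rfl, e.symm⟩)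
      · exact h1 (Or.inl ⟨rfl, e.symm⟩)
    · have : spinAt s z = 0 ∨ spinAt s z = 1 := by
        unfold spinAt; split_ifs <;> simp
      rcases this with e | e
      · exact h0 (Or.inr ⟨hzx, hzh, e.symm⟩)
      · exact h1 (Or.inr ⟨hzx, hzh, e.symm⟩)
  · rintro rfl
    exact ⟨fun h' => h'.elim (fun e => hx e.1) (fun e => e.1 rfl),
      fun h' => h'.elim (fun e => hx e.1) (fun e => e.1 rfl)⟩

/-- Moving an electron into the hole gives again a one-hole configuration. [folklore] -/
theorem isOneHole_move (hs : IsOneHole s) (hh : holes s = {h}) (hx : x ≠ h) :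
    IsOneHole (move s x h) :=
  ⟨(card_move hh hx).trans hs.1, not_hasDoubleOccupancy_move hs.2 hh hx⟩

/-- The moved electron keeps its spin. [folklore] -/
theorem spinAt_move_self (hs : ¬ HasDoubleOccupancy s) (hh : holes s = {h}) (hx : x ≠ h) :
    spinAt (move s x h) h = spinAt s x := by
  have hmem : orb h (spinAt s x) ∈ move s x h := (orb_mem_move_iff hs hh hx).2 (Or.inl ⟨rfl, rfl⟩)
  exact (eq_spinAt_of_mem (not_hasDoubleOccupancy_move hs hh hx) hmem).symm

/-- Spectator electrons keep their spins under a move. [folklore] -/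
theorem spinAt_move_of_ne (hs : ¬ HasDoubleOccupancy s) (hh : holes s = {h}) (hx : x ≠ h)
    {z : Λ} (hzx : z ≠ x) (hzh : z ≠ h) : spinAt (move s x h) z = spinAt s z := by
  have hmem : orb z (spinAt s z) ∈ move s x h :=
    (orb_mem_move_iff hs hh hx).2 (Or.inr ⟨hzx, hzh, rfl⟩)
  exact (eq_spinAt_of_mem (not_hasDoubleOccupancy_move hs hh hx) hmem).symm

/-- Moving the hole back restores the configuration. [folklore] -/
theorem move_move (hs : ¬ HasDoubleOccupancy s) (hh : holes s = {h}) (hx : x ≠ h) :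
    move (move s x h) h x = s := by
  have hs' := not_hasDoubleOccupancy_move hs hh hx
  have hh' := holes_move hs hh hx
  ext o
  rcases eq_orb_zero_or_one o with e | e <;>
  · rw [e, orb_mem_move_iff hs' hh' hx.symm, orb_mem_iff hs hh, spinAt_move_self hs hh hx]
    constructor
    · rintro (⟨h1, h2⟩ | ⟨h1, h2, h3⟩)
      · exact ⟨h1 ▸ hx, h1 ▸ h2⟩
      · exact ⟨h1, h3.trans (spinAt_move_of_ne hs hh hx h2 h1)⟩
    · rintro ⟨h1, h2⟩
      by_cases hzx : site o = x
      · exact Or.inl ⟨hzx, hzx ▸ h2⟩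
      · exact Or.inr ⟨h1, hzx, h2.trans (spinAt_move_of_ne hs hh hx hzx h1).symm⟩

/-- A move preserves the number of down spins (and hence `S^z`). [folklore] -/
theorem downCount_move (hs : ¬ HasDoubleOccupancy s) (hh : holes s = {h}) (hx : x ≠ h) :
    downCount (move s x h) = downCount s := by
  unfold downCount
  -- the bijection swapping `x` and `h`
  refine Finset.card_bij (fun z _ => if z = h then x else z) ?_ ?_ ?_
  · intro z hz
    have hz' : orb z 1 ∈ move s x h := (mem_filter.1 hz).2
    refine mem_filter.2 ⟨mem_univ _, ?_⟩
    rw [orb_mem_move_iff hs hh hx] at hz'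
    rcases hz' with ⟨hzh, e⟩ | ⟨hzx, hzh, e⟩
    · rw [if_pos hzh, e]; exact orb_spinAt_mem hh hx
    · rw [if_neg hzh, e]; exact orb_spinAt_mem hh hzh
  · intro a ha b hb hab
    have ha : orb a 1 ∈ move s x h := (mem_filter.1 ha).2
    have hb : orb b 1 ∈ move s x h := (mem_filter.1 hb).2
    rw [orb_mem_move_iff hs hh hx] at ha hb
    by_cases hah : a = h <;> by_cases hbh : b = h
    · exact hah.trans hbh.symm
    · rw [if_pos hah, if_neg hbh] at hab
      rcases hb with ⟨e, -⟩ | ⟨hbx, -, -⟩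
      · exact absurd e hbh
      · exact absurd hab.symm hbx
    · rw [if_neg hah, if_pos hbh] at hab
      rcases ha with ⟨e, -⟩ | ⟨hax, -, -⟩
      · exact absurd e hah
      · exact absurd hab hax
    · rwa [if_neg hah, if_neg hbh] at hab
  · intro b hb
    have hb' : orb b 1 ∈ s := (mem_filter.1 hb).2
    have hbh : b ≠ h := ne_of_mem_of_holes_eq hh hb'
    by_cases hbx : b = x
    · subst hbx
      refine ⟨h, mem_filter.2 ⟨mem_univ _, ?_⟩, by rw [if_pos rfl]⟩
      rw [orb_mem_move_iff hs hh hx]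
      exact Or.inl ⟨rfl, eq_spinAt_of_mem hs hb'⟩
    · refine ⟨b, mem_filter.2 ⟨mem_univ _, ?_⟩, by rw [if_neg hbh]⟩
      rw [orb_mem_move_iff hs hh hx]
      exact Or.inr ⟨hbx, hbh, eq_spinAt_of_mem hs hb'⟩

/-- Different electrons moved into the hole give different configurations. [folklore] -/
theorem move_injective (hs : ¬ HasDoubleOccupancy s) (hh : holes s = {h}) {x y : Λ} (hx : x ≠ h)
    (hy : y ≠ h) (e : move s x h = move s y h) : x = y := by
  have h1 := holes_move hs hh hx
  rw [e, holes_move hs hh hy] at h1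
  exact (Finset.singleton_injective h1).symm

variable (G : SimpleGraph Λ)

/-- For a one-hole configuration, Tasaki's hole hops are exactly the moves of a neighbouring electron
into the hole. [folklore] -/
theorem isHoleHop_iff (hs : ¬ HasDoubleOccupancy s) (hh : holes s = {h}) {s' : Finset (Orb Λ)} :
    IsHoleHop G s s' ↔ ∃ y, G.Adj h y ∧ s' = move s y h := by
  constructor
  · rintro ⟨x, y, σ, hadj, hy, hx0, hx1, rfl⟩
    have hxh : x = h := by
      have : x ∈ holes s := mem_holes.2 ⟨hx0, hx1⟩
      rwa [hh, mem_singleton] at this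
    subst hxh
    refine ⟨y, hadj, ?_⟩
    rw [move, ← eq_spinAt_of_mem hs hy]
  · rintro ⟨y, hadj, rfl⟩
    have hyh : y ≠ h := hadj.ne.symm
    exact ⟨h, y, spinAt s y, hadj, orb_spinAt_mem hh hyh, not_mem_of_holes_eq hh 0,
      not_mem_of_holes_eq hh 1, rfl⟩

/-- Hole hops between one-hole configurations are reversible. [folklore] -/
theorem isHoleHop_symm_of_holes_eq (hs : ¬ HasDoubleOccupancy s) (hh : holes s = {h})
    {s' : Finset (Orb Λ)} (hhop : IsHoleHop G s s') : IsHoleHop G s' s := by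
  obtain ⟨y, hadj, rfl⟩ := (isHoleHop_iff G hs hh).1 hhop
  have hyh : y ≠ h := hadj.ne.symm
  rw [isHoleHop_iff G (not_hasDoubleOccupancy_move hs hh hyh) (holes_move hs hh hyh)]
  exact ⟨h, hadj.symm, (move_move hs hh hyh).symm⟩

end Move

/-! ### P3c. Jordan–Wigner signs of a hole hop and the gauge transformation -/

section Gauge

variable {Λ : Type*} [LinearOrder Λ] [Fintype Λ]

/-- The number of electrons strictly to the left of the site `y`. [folklore] -/
def nuLeft (s : Finset (Orb Λ)) (y : Λ) : ℕ := (s.filter fun o => site o < y).card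

omit [Fintype Λ] in
/-- At an empty site the Jordan–Wigner sign only counts electrons to the left of the site. [folklore] -/
theorem jwSign_orb_of_empty {u : Finset (Orb Λ)} {y : Λ} (h0 : orb y 0 ∉ u) (h1 : orb y 1 ∉ u)
    (τ : Fin 2) : jwSign (orb y τ) u = (-1) ^ nuLeft u y := by
  unfold jwSign nuLeft
  congr 2
  apply Finset.filter_congr
  intro o ho
  have hne : site o ≠ y := by
    rintro rfl
    rcases eq_orb_zero_or_one o with e | e
    · rw [e] at ho; exact h0 ho
    · rw [e] at ho; exact h1 ho
  rw [Prod.Lex.lt_iff]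
  change site o < y ∨ site o = y ∧ _ ↔ site o < y
  exact ⟨fun h' => h'.elim id fun h'' => absurd h''.1 hne, Or.inl⟩

omit [Fintype Λ] in
/-- Adding an electron adds one to the left-count of every site to its right. [folklore] -/
theorem nuLeft_insert {u : Finset (Orb Λ)} {o : Orb Λ} (ho : o ∉ u) (y : Λ) :
    nuLeft (insert o u) y = nuLeft u y + if site o < y then 1 else 0 := by
  unfold nuLeft
  rw [Finset.filter_insert]
  split_ifs with h
  · rw [Finset.card_insert_of_notMem fun h' => ho (Finset.mem_of_mem_filter _ h')]
  · rw [add_zero]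

/-- The gauge sign of a configuration: the parity of the number of electrons to the left of its
hole(s) (for a one-hole configuration with hole `h`, `(-1)^{#{electrons left of h}}`). This is the
sign change of basis that makes all hopping amplitudes of the one-hole `U = ∞` model equal to `+t`.
[cite: Tasaki1989, Theorem] -/
def gauge (s : Finset (Orb Λ)) : ℂ := ∏ h ∈ holes s, (-1) ^ nuLeft s h

/-- The gauge sign squares to one. [folklore] -/
theorem gauge_mul_self (s : Finset (Orb Λ)) : gauge s * gauge s = 1 := by
  rw [gauge, ← Finset.prod_mul_distrib]
  refine Finset.prod_eq_one fun h _ => ?_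
  rw [← pow_add, ← two_mul, pow_mul]
  norm_num

/-- The gauge sign is nonzero. [folklore] -/
theorem gauge_ne_zero (s : Finset (Orb Λ)) : gauge s ≠ 0 := fun h => by
  simpa [h] using gauge_mul_self s

/-- The gauge sign is real. [folklore] -/
@[simp] theorem star_gauge (s : Finset (Orb Λ)) : star (gauge s) = gauge s := by
  simp [gauge]

/-- The gauge sign has modulus one. [folklore] -/
theorem normSq_gauge (s : Finset (Orb Λ)) : Complex.normSq (gauge s) = 1 := by
  have h1 : (starRingEnd ℂ) (gauge s) = gauge s := star_gauge s
  have h2 := Complex.mul_conj (gauge s)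
  rw [h1, gauge_mul_self] at h2
  exact_mod_cast h2.symm

/-- The gauge sign of a one-hole configuration: parity of the number of electrons left of the hole. [folklore] -/
theorem gauge_eq_of_holes_eq {s : Finset (Orb Λ)} {h : Λ} (hh : holes s = {h}) :
    gauge s = (-1) ^ nuLeft s h := by
  rw [gauge, hh, prod_singleton]

/-- **The sign of a hole hop.** Moving the electron at `x` into the hole `h` produces the
Jordan–Wigner sign `-(gauge s)(gauge s')`: in the gauged basis every hop has amplitude exactly `+t`
for the Hamiltonian `-t Σ c†c`. [cite: Tasaki1989, Theorem] -/
theorem jwSign_hop {s : Finset (Orb Λ)} {h x : Λ} (hs : ¬ HasDoubleOccupancy s)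
    (hh : holes s = {h}) (hx : x ≠ h) :
    jwSign (orb x (spinAt s x)) (s.erase (orb x (spinAt s x))) *
        jwSign (orb h (spinAt s x)) (s.erase (orb x (spinAt s x))) =
      -(gauge s * gauge (move s x h)) := by
  set σ := spinAt s x with hσ
  set u := s.erase (orb x σ) with hu
  have hxu : ∀ τ, orb x τ ∉ u := fun τ h' => by
    have h'' := Finset.mem_erase.1 h'
    exact h''.1 (by rw [eq_spinAt_of_mem hs h''.2])
  have hhu : ∀ τ, orb h τ ∉ u := fun τ h' => not_mem_of_holes_eq hh τ (mem_of_mem_erase h')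
  rw [jwSign_orb_of_empty (hxu 0) (hxu 1), jwSign_orb_of_empty (hhu 0) (hhu 1)]
  have hs_eq : s = insert (orb x σ) u := (Finset.insert_erase (orb_spinAt_mem hh hx)).symm
  have hmove : move s x h = insert (orb h σ) u := rfl
  have h1 : nuLeft s h = nuLeft u h + if x < h then 1 else 0 := by
    conv_lhs => rw [hs_eq]
    rw [nuLeft_insert (hxu σ)]
    rfl
  have h2 : nuLeft (move s x h) x = nuLeft u x + if h < x then 1 else 0 := by
    rw [hmove, nuLeft_insert (hhu σ)]
    rfl
  rw [gauge_eq_of_holes_eq hh, gauge_eq_of_holes_eq (holes_move hs hh hx), h1, h2]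
  rcases lt_or_gt_of_ne hx with hlt | hlt
  · rw [if_pos hlt, if_neg (not_lt.2 hlt.le)]
    ring
  · rw [if_neg (not_lt.2 hlt.le), if_pos hlt]
    ring

omit [LinearOrder Λ] [Fintype Λ] in
/-- Two different spins at one site is a double occupancy. [folklore] -/
theorem hasDoubleOccupancy_of_ne {r : Finset (Orb Λ)} {y : Λ} {σ τ : Fin 2} (hσ : orb y σ ∈ r)
    (hτ : orb y τ ∈ r) (hne : σ ≠ τ) : HasDoubleOccupancy r := by
  fin_cases σ <;> fin_cases τ
  · exact absurd rfl hne
  · exact ⟨y, hσ, hτ⟩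
  · exact ⟨y, hτ, hσ⟩
  · exact absurd rfl hne

variable (G : SimpleGraph Λ) [DecidableRel G.Adj]

/-- **The `U = ∞` Hamiltonian in the one-hole sector.** On a Gutzwiller amplitude, at a one-hole
configuration `s` with hole `h`, `(Hψ)(s) = t · gauge(s) · Σ_{y ∼ h} gauge(s_y) ψ(s_y)`, where `s_y`
is `s` with the electron at `y` moved into the hole: in the gauged basis the hole hops with
amplitude `+t` along the edges of `G`. [cite: Tasaki1989, Theorem] -/
theorem hubbardInfty_mulVec_of_holes_eq (t : ℝ) {ψ : Fock (Orb Λ)} (hG : IsGutzwiller ψ)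
    {s : Finset (Orb Λ)} (hs : ¬ HasDoubleOccupancy s) {h : Λ} (hh : holes s = {h}) :
    (hubbardInfty G t *ᵥ ψ) s =
      (t : ℂ) * gauge s * ∑ y ∈ univ.filter (G.Adj h ·), gauge (move s y h) * ψ (move s y h) := by
  rw [hubbardInfty_mulVec_apply G t hG, if_neg hs, hamiltonian_zero_mulVec_apply, Finset.sum_comm]
  simp only [LiebThm1.creation_mul_annihilation_mulVec_apply]
  have key : ∀ x, (∑ σ : Fin 2, if G.Adj x h then
      (if orb x σ ∈ s ∧ orb h σ ∉ s.erase (orb x σ) then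
        jwSign (orb x σ) (s.erase (orb x σ)) * jwSign (orb h σ) (s.erase (orb x σ)) *
          ψ (insert (orb h σ) (s.erase (orb x σ))) else 0) else 0) =
      if G.Adj h x then -(gauge s * gauge (move s x h)) * ψ (move s x h) else 0 := by
    intro x
    by_cases hadj : G.Adj x h
    · have hxh : x ≠ h := hadj.ne
      rw [if_pos hadj.symm]
      simp only [if_pos hadj]
      rw [Finset.sum_eq_single (spinAt s x)]
      · rw [if_pos ⟨orb_spinAt_mem hh hxh, fun h' => not_mem_of_holes_eq hh _ (mem_of_mem_erase h')⟩,
          jwSign_hop hs hh hxh]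
        rfl
      · intro σ _ hσ
        rw [if_neg]
        rintro ⟨hmem, -⟩
        exact hσ (eq_spinAt_of_mem hs hmem)
      · intro h'
        exact absurd (mem_univ _) h'
    · rw [if_neg fun h' => hadj h'.symm]
      simp only [if_neg hadj, Finset.sum_const_zero]
  rw [Finset.sum_eq_single h]
  · rw [Finset.sum_congr rfl fun x _ => key x, ← Finset.sum_filter, Finset.mul_sum, Finset.mul_sum]
    refine Finset.sum_congr rfl fun x _ => ?_
    ring
  · intro y _ hyh
    refine Finset.sum_eq_zero fun x _ => Finset.sum_eq_zero fun σ _ => ?_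
    by_cases hadj : G.Adj x y
    · rw [if_pos hadj]
      by_cases hcond : orb x σ ∈ s ∧ orb y σ ∉ s.erase (orb x σ)
      · rw [if_pos hcond]
        have hyocc : orb y (spinAt s y) ∈ s := orb_spinAt_mem hh hyh
        have hxy : x ≠ y := hadj.ne
        have hne : σ ≠ spinAt s y := by
          rintro rfl
          refine hcond.2 (Finset.mem_erase.2 ⟨?_, hyocc⟩)
          rw [Ne, orb_inj]
          exact fun e => hxy e.1.symm
        rw [hG _ (hasDoubleOccupancy_of_ne (Finset.mem_insert_self _ _)
          (Finset.mem_insert_of_mem (Finset.mem_erase.2 ⟨?_, hyocc⟩)) hne), mul_zero]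
        rw [Ne, orb_inj]
        exact fun e => hxy e.1.symm
      · rw [if_neg hcond]
    · rw [if_neg hadj]
  · intro h'
    exact absurd (mem_univ _) h'

/-- Off the one-hole configurations, `Hψ` vanishes for every one-hole Gutzwiller amplitude `ψ`. [folklore] -/
theorem hubbardInfty_mulVec_of_not_isOneHole (t : ℝ) {ψ : Fock (Orb Λ)}
    (hN : IsNParticle (Fintype.card Λ - 1) ψ) (hG : IsGutzwiller ψ) {s : Finset (Orb Λ)}
    (hs : ¬ IsOneHole s) : (hubbardInfty G t *ᵥ ψ) s = 0 := by
  rw [hubbardInfty_mulVec_apply G t hG]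
  by_cases hd : HasDoubleOccupancy s
  · rw [if_pos hd]
  · rw [if_neg hd, hamiltonian_zero_mulVec_apply]
    have hcard : s.card ≠ Fintype.card Λ - 1 := fun h => hs ⟨h, hd⟩
    rw [Finset.sum_eq_zero, mul_zero]
    intro x _
    refine Finset.sum_eq_zero fun y _ => Finset.sum_eq_zero fun σ _ => ?_
    by_cases hadj : G.Adj x y
    · rw [if_pos hadj, LiebThm1.creation_mul_annihilation_mulVec_apply]
      by_cases hcond : orb x σ ∈ s ∧ orb y σ ∉ s.erase (orb x σ)
      · rw [if_pos hcond, hN _ ?_, mul_zero]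
        rw [Finset.card_insert_of_notMem hcond.2, Finset.card_erase_of_mem hcond.1]
        have : 0 < s.card := Finset.card_pos.2 ⟨_, hcond.1⟩
        omega
      · rw [if_neg hcond]
    · rw [if_neg hadj]

end Gauge

/-! ### P2. The ground-state transformation (Perron–Frobenius by a positive subeigenvector)

If `B ≥ 0` is symmetric and `g > 0` satisfies `B g ≤ λ g`, then `⟨f, B f⟩ ≤ λ ‖f‖²`, with equality
only if `f / g` is constant across every edge `B s s' ≠ 0`: the identity
`Σ B_{ss'} g_s g_{s'} (u_s - u_{s'})² = 2 Σ_s u_s² g_s (Bg)_s - 2 ⟨gu, B gu⟩`. -/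

section GroundStateTransformation

variable {S : Type*} [Fintype S]

/-- Real form of the ground-state-transformation bound and its equality case. [folklore] -/
theorem quadratic_le_of_subeigenvector (B : S → S → ℝ) (hB0 : ∀ s s', 0 ≤ B s s')
    (hBs : ∀ s s', B s s' = B s' s) (g : S → ℝ) (hg : ∀ s, 0 < g s) (lam : ℝ)
    (hsub : ∀ s, ∑ s', B s s' * g s' ≤ lam * g s) (a : S → ℝ) :
    ∑ s, ∑ s', B s s' * (a s * a s') ≤ lam * ∑ s, a s ^ 2 ∧
      (∑ s, ∑ s', B s s' * (a s * a s') = lam * ∑ s, a s ^ 2 →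
        ∀ s s', B s s' ≠ 0 → a s * g s' = a s' * g s) := by
  set u : S → ℝ := fun s => a s / g s with hu
  have hau : ∀ s, a s = g s * u s := fun s => by
    simp only [hu]
    rw [mul_div_cancel₀ _ (hg s).ne']
  -- the three pieces of the identity
  have hX : ∑ s, ∑ s', B s s' * g s * g s' * u s ^ 2 = ∑ s, u s ^ 2 * g s * ∑ s', B s s' * g s' := by
    refine Finset.sum_congr rfl fun s _ => ?_
    rw [Finset.mul_sum]
    exact Finset.sum_congr rfl fun s' _ => by ring
  have hY : ∑ s, ∑ s', B s s' * g s * g s' * u s' ^ 2 = ∑ s, u s ^ 2 * g s * ∑ s', B s s' * g s' := by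
    rw [Finset.sum_comm]
    refine Finset.sum_congr rfl fun s _ => ?_
    rw [Finset.mul_sum]
    exact Finset.sum_congr rfl fun s' _ => by rw [hBs s' s]; ring
  have hZ : ∑ s, ∑ s', B s s' * g s * g s' * (u s * u s') = ∑ s, ∑ s', B s s' * (a s * a s') := by
    refine Finset.sum_congr rfl fun s _ => Finset.sum_congr rfl fun s' _ => ?_
    rw [hau s, hau s']
    ring
  have hI : ∑ s, ∑ s', B s s' * g s * g s' * (u s - u s') ^ 2 =
      2 * (∑ s, u s ^ 2 * g s * ∑ s', B s s' * g s') - 2 * ∑ s, ∑ s', B s s' * (a s * a s') := by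
    have e : ∀ s s', B s s' * g s * g s' * (u s - u s') ^ 2 =
        B s s' * g s * g s' * u s ^ 2 + B s s' * g s * g s' * u s' ^ 2 -
          2 * (B s s' * g s * g s' * (u s * u s')) := fun s s' => by ring
    simp only [e, Finset.sum_add_distrib, Finset.sum_sub_distrib, ← Finset.mul_sum, hX, hY, hZ]
    ring
  have hI0 : 0 ≤ ∑ s, ∑ s', B s s' * g s * g s' * (u s - u s') ^ 2 :=
    Finset.sum_nonneg fun s _ => Finset.sum_nonneg fun s' _ =>
      mul_nonneg (mul_nonneg (mul_nonneg (hB0 s s') (hg s).le) (hg s').le) (sq_nonneg _)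
  have hT : ∑ s, u s ^ 2 * g s * ∑ s', B s s' * g s' ≤ lam * ∑ s, a s ^ 2 := by
    rw [Finset.mul_sum]
    refine Finset.sum_le_sum fun s _ => ?_
    have h1 : u s ^ 2 * g s * (∑ s', B s s' * g s') ≤ u s ^ 2 * g s * (lam * g s) :=
      mul_le_mul_of_nonneg_left (hsub s) (mul_nonneg (sq_nonneg _) (hg s).le)
    have h2 : u s ^ 2 * g s * (lam * g s) = lam * a s ^ 2 := by rw [hau s]; ring
    linarith
  refine ⟨by linarith, fun heq s s' hB => ?_⟩
  have hIz : ∑ s, ∑ s', B s s' * g s * g s' * (u s - u s') ^ 2 = 0 := by linarith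
  have hterm : B s s' * g s * g s' * (u s - u s') ^ 2 = 0 := by
    have h1 := (Finset.sum_eq_zero_iff_of_nonneg fun s _ => Finset.sum_nonneg fun s' _ =>
      mul_nonneg (mul_nonneg (mul_nonneg (hB0 s s') (hg s).le) (hg s').le) (sq_nonneg _)).1
        hIz s (mem_univ _)
    exact (Finset.sum_eq_zero_iff_of_nonneg fun s' _ =>
      mul_nonneg (mul_nonneg (mul_nonneg (hB0 s s') (hg s).le) (hg s').le) (sq_nonneg _)).1
        h1 s' (mem_univ _)
  have hu_eq : u s = u s' := by
    have : (u s - u s') ^ 2 = 0 := by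
      rcases mul_eq_zero.1 hterm with h1 | h1
      · rcases mul_eq_zero.1 h1 with h2 | h2
        · rcases mul_eq_zero.1 h2 with h3 | h3
          · exact absurd h3 hB
          · exact absurd h3 (hg s).ne'
        · exact absurd h2 (hg s').ne'
      · exact h1
    have := pow_eq_zero_iff (n := 2) (by norm_num) |>.1 this
    linarith
  have := hu_eq
  simp only [hu] at this
  rw [div_eq_div_iff (hg s).ne' (hg s').ne'] at this
  exact this

/-- Complex form: `Re ⟨f, B f⟩ ≤ λ Σ |f|²`, with equality only if `f/g` is constant across the edges
of `B`. [folklore] -/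
theorem re_quadratic_le_of_subeigenvector (B : S → S → ℝ) (hB0 : ∀ s s', 0 ≤ B s s')
    (hBs : ∀ s s', B s s' = B s' s) (g : S → ℝ) (hg : ∀ s, 0 < g s) (lam : ℝ)
    (hsub : ∀ s, ∑ s', B s s' * g s' ≤ lam * g s) (f : S → ℂ) :
    (∑ s, ∑ s', (B s s' : ℂ) * (starRingEnd ℂ (f s) * f s')).re ≤
        lam * ∑ s, Complex.normSq (f s) ∧
      ((∑ s, ∑ s', (B s s' : ℂ) * (starRingEnd ℂ (f s) * f s')).re =
          lam * ∑ s, Complex.normSq (f s) →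
        ∀ s s', B s s' ≠ 0 → f s * g s' = f s' * g s) := by
  set a : S → ℝ := fun s => (f s).re
  set b : S → ℝ := fun s => (f s).im
  have hre : (∑ s, ∑ s', (B s s' : ℂ) * (starRingEnd ℂ (f s) * f s')).re =
      ∑ s, ∑ s', B s s' * (a s * a s') + ∑ s, ∑ s', B s s' * (b s * b s') := by
    rw [Complex.re_sum, ← Finset.sum_add_distrib]
    refine Finset.sum_congr rfl fun s _ => ?_
    rw [Complex.re_sum, ← Finset.sum_add_distrib]
    refine Finset.sum_congr rfl fun s' _ => ?_
    simp only [Complex.mul_re, Complex.ofReal_re, Complex.ofReal_im, Complex.conj_re,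
      Complex.conj_im, zero_mul, sub_zero, a, b]
    ring
  have hnsq : ∑ s, Complex.normSq (f s) = ∑ s, a s ^ 2 + ∑ s, b s ^ 2 := by
    rw [← Finset.sum_add_distrib]
    refine Finset.sum_congr rfl fun s _ => ?_
    rw [Complex.normSq_apply]
    ring
  obtain ⟨ha1, ha2⟩ := quadratic_le_of_subeigenvector B hB0 hBs g hg lam hsub a
  obtain ⟨hb1, hb2⟩ := quadratic_le_of_subeigenvector B hB0 hBs g hg lam hsub b
  rw [hre, hnsq, mul_add]
  refine ⟨add_le_add ha1 hb1, fun heq s s' hB => ?_⟩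
  have hea : ∑ s, ∑ s', B s s' * (a s * a s') = lam * ∑ s, a s ^ 2 := by linarith
  have heb : ∑ s, ∑ s', B s s' * (b s * b s') = lam * ∑ s, b s ^ 2 := by linarith
  have h1 := ha2 hea s s' hB
  have h2 := hb2 heb s s' hB
  apply Complex.ext
  · simpa [Complex.mul_re, a] using h1
  · simpa [Complex.mul_im, b] using h2

end GroundStateTransformation

/-! ### P1. A Perron eigenvector for a connected finite graph (variational construction) -/

section PerronVector

variable {V : Type*} [Fintype V]

/-- The bilinear form `Σ_{x,y} A_{xy} φ_x ψ_y` of a real matrix given as a function. [folklore] -/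
def bilin (A : V → V → ℝ) (φ ψ : V → ℝ) : ℝ := ∑ x, ∑ y, A x y * (φ x * ψ y)

/-- `bilin` is additive in the first argument. [folklore] -/
theorem bilin_add_left (A : V → V → ℝ) (φ ψ χ : V → ℝ) :
    bilin A (φ + ψ) χ = bilin A φ χ + bilin A ψ χ := by
  simp only [bilin, Pi.add_apply, ← Finset.sum_add_distrib]
  exact Finset.sum_congr rfl fun x _ => Finset.sum_congr rfl fun y _ => by ring

/-- `bilin` is additive in the second argument. [folklore] -/
theorem bilin_add_right (A : V → V → ℝ) (φ ψ χ : V → ℝ) :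
    bilin A φ (ψ + χ) = bilin A φ ψ + bilin A φ χ := by
  simp only [bilin, Pi.add_apply, ← Finset.sum_add_distrib]
  exact Finset.sum_congr rfl fun x _ => Finset.sum_congr rfl fun y _ => by ring

/-- `bilin` is homogeneous in the first argument. [folklore] -/
theorem bilin_smul_left (A : V → V → ℝ) (c : ℝ) (φ ψ : V → ℝ) :
    bilin A (c • φ) ψ = c * bilin A φ ψ := by
  simp only [bilin, Pi.smul_apply, smul_eq_mul, Finset.mul_sum]
  exact Finset.sum_congr rfl fun x _ => Finset.sum_congr rfl fun y _ => by ring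

/-- `bilin` is homogeneous in the second argument. [folklore] -/
theorem bilin_smul_right (A : V → V → ℝ) (c : ℝ) (φ ψ : V → ℝ) :
    bilin A φ (c • ψ) = c * bilin A φ ψ := by
  simp only [bilin, Pi.smul_apply, smul_eq_mul, Finset.mul_sum]
  exact Finset.sum_congr rfl fun x _ => Finset.sum_congr rfl fun y _ => by ring

/-- `bilin` of a symmetric matrix is symmetric. [folklore] -/
theorem bilin_comm {A : V → V → ℝ} (hA : ∀ x y, A x y = A y x) (φ ψ : V → ℝ) :
    bilin A φ ψ = bilin A ψ φ := by
  unfold bilin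
  rw [Finset.sum_comm]
  exact Finset.sum_congr rfl fun x _ => Finset.sum_congr rfl fun y _ => by rw [hA y x]; ring

/-- `bilin` against a basis vector is a matrix–vector product entry. [folklore] -/
theorem bilin_single_right [DecidableEq V] (A : V → V → ℝ) (φ : V → ℝ) (x : V) :
    bilin A φ (Pi.single x 1) = ∑ y, A y x * φ y := by
  unfold bilin
  refine Finset.sum_congr rfl fun y _ => ?_
  rw [Finset.sum_eq_single x]
  · simp
  · intro z _ hz
    simp [hz]
  · intro h
    exact absurd (mem_univ _) h

/-- A one-variable polynomial `2βε + αε²` that is nonnegative for all real `ε` has `β = 0`. [folklore] -/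
theorem eq_zero_of_forall_quadratic_nonneg {α β : ℝ} (h : ∀ ε : ℝ, 0 ≤ 2 * β * ε + α * ε ^ 2) :
    β = 0 := by
  by_contra hβ
  set d := |α| + 1 with hd
  have hdpos : 0 < d := by positivity
  have key := h (-β / d)
  have hval : 2 * β * (-β / d) + α * (-β / d) ^ 2 = β ^ 2 / d ^ 2 * (α - 2 * d) := by
    field_simp
    ring
  rw [hval] at key
  have h1 : 0 < β ^ 2 / d ^ 2 := by positivity
  have h2 : α - 2 * d < 0 := by
    have := le_abs_self α
    linarith
  nlinarith

variable (G : SimpleGraph V) [DecidableRel G.Adj]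

/-- **Perron vector of a connected graph (variational).** A finite connected graph in which every
vertex has a neighbour admits a strictly positive eigenvector of its adjacency matrix with a
strictly positive eigenvalue (the maximiser of the adjacency quadratic form on the unit sphere, made
nonnegative by taking absolute values). [folklore] -/
theorem exists_pos_adj_eigenvector [Nonempty V] (hconn : G.Preconnected)
    (hnb : ∀ x, ∃ y, G.Adj x y) :
    ∃ (lam : ℝ) (g : V → ℝ), 0 < lam ∧ (∀ x, 0 < g x) ∧
      ∀ x, ∑ y, (if G.Adj x y then g y else 0) = lam * g x := by
  classical
  let A : V → V → ℝ := fun x y => if G.Adj x y then 1 else 0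
  have hA0 : ∀ x y, 0 ≤ A x y := fun x y => by simp only [A]; split_ifs <;> norm_num
  have hAs : ∀ x y, A x y = A y x := fun x y => by simp only [A, G.adj_comm]
  let Q : (V → ℝ) → ℝ := fun φ => bilin A φ φ
  let K : Set (V → ℝ) := {φ | ∑ x, φ x ^ 2 = 1}
  -- compactness of the unit sphere of `ℓ²` inside the sup-normed `V → ℝ`
  have hK : IsCompact K := by
    refine (isCompact_closedBall (0 : V → ℝ) 1).of_isClosed_subset ?_ ?_
    · exact isClosed_eq (continuous_finsetSum _ fun x _ => (continuous_apply x).pow 2)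
        continuous_const
    · intro φ hφ
      rw [Metric.mem_closedBall, dist_zero_right, pi_norm_le_iff_of_nonneg zero_le_one]
      intro x
      rw [Real.norm_eq_abs, ← sq_le_one_iff_abs_le_one]
      calc φ x ^ 2 ≤ ∑ y, φ y ^ 2 :=
            Finset.single_le_sum (fun y _ => sq_nonneg (φ y)) (mem_univ x)
        _ = 1 := hφ
  obtain ⟨x₀⟩ := ‹Nonempty V›
  have hKne : K.Nonempty := ⟨fun x => if x = x₀ then 1 else 0, by simp [K, Finset.sum_ite_eq']⟩
  have hQc : Continuous Q := by
    refine continuous_finsetSum _ fun x _ => continuous_finsetSum _ fun y _ => ?_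
    exact continuous_const.mul ((continuous_apply x).mul (continuous_apply y))
  obtain ⟨φ₁, hφ₁K, hmax⟩ := hK.exists_isMaxOn hKne hQc.continuousOn
  let φ₂ : V → ℝ := fun x => |φ₁ x|
  have hφ₂K : φ₂ ∈ K := by
    change ∑ x, |φ₁ x| ^ 2 = 1
    simp only [sq_abs]
    exact hφ₁K
  have hQ12 : Q φ₁ ≤ Q φ₂ := by
    refine Finset.sum_le_sum fun x _ => Finset.sum_le_sum fun y _ => ?_
    refine mul_le_mul_of_nonneg_left ?_ (hA0 x y)
    rw [← abs_mul]
    exact le_abs_self _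
  have hmax2 : ∀ φ ∈ K, Q φ ≤ Q φ₂ := fun φ hφ => (hmax hφ).trans hQ12
  set lam := Q φ₂ with hlam
  -- the homogeneous bound `Q φ ≤ lam ‖φ‖²`
  have hbound : ∀ φ : V → ℝ, Q φ ≤ lam * ∑ x, φ x ^ 2 := by
    intro φ
    by_cases hc : ∑ x, φ x ^ 2 = 0
    · have hφ0 : ∀ x, φ x = 0 := fun x =>
        pow_eq_zero_iff two_ne_zero |>.1
          ((Finset.sum_eq_zero_iff_of_nonneg fun y _ => sq_nonneg (φ y)).1 hc x (mem_univ x))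
      have : Q φ = 0 := by
        refine Finset.sum_eq_zero fun x _ => Finset.sum_eq_zero fun y _ => ?_
        rw [hφ0 x, zero_mul, mul_zero]
      rw [this, hc, mul_zero]
    · have hcpos : 0 < ∑ x, φ x ^ 2 :=
        lt_of_le_of_ne (Finset.sum_nonneg fun y _ => sq_nonneg _) (Ne.symm hc)
      set c := ∑ x, φ x ^ 2 with hcdef
      set r := (Real.sqrt c)⁻¹ with hrdef
      have hr : r ^ 2 * c = 1 := by
        rw [hrdef, inv_pow, Real.sq_sqrt hcpos.le, inv_mul_cancel₀ hc]
      have hψK : (r • φ) ∈ K := by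
        change ∑ x, (r • φ) x ^ 2 = 1
        simp only [Pi.smul_apply, smul_eq_mul, mul_pow, ← Finset.mul_sum]
        exact hr
      have h1 : Q (r • φ) = r ^ 2 * Q φ := by
        change bilin A (r • φ) (r • φ) = r ^ 2 * bilin A φ φ
        rw [bilin_smul_left, bilin_smul_right]
        ring
      have h2 := hmax2 _ hψK
      rw [h1] at h2
      calc Q φ = r ^ 2 * Q φ * c := by rw [mul_right_comm, hr, one_mul]
        _ ≤ lam * c := mul_le_mul_of_nonneg_right h2 hcpos.le
  -- polarization: `φ₂` is an eigenvector
  have hpol : ∀ ψ : V → ℝ, bilin A φ₂ ψ = lam * ∑ x, φ₂ x * ψ x := by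
    intro ψ
    have hquad : ∀ ε : ℝ, 0 ≤ 2 * (lam * ∑ x, φ₂ x * ψ x - bilin A φ₂ ψ) * ε +
        (lam * ∑ x, ψ x ^ 2 - Q ψ) * ε ^ 2 := by
      intro ε
      have hb := hbound (φ₂ + ε • ψ)
      have e1 : ∑ x, (φ₂ + ε • ψ) x ^ 2 =
          ∑ x, φ₂ x ^ 2 + 2 * ε * ∑ x, φ₂ x * ψ x + ε ^ 2 * ∑ x, ψ x ^ 2 := by
        simp only [Pi.add_apply, Pi.smul_apply, smul_eq_mul, Finset.mul_sum,
          ← Finset.sum_add_distrib]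
        exact Finset.sum_congr rfl fun x _ => by ring
      have e2 : Q (φ₂ + ε • ψ) = Q φ₂ + 2 * ε * bilin A φ₂ ψ + ε ^ 2 * Q ψ := by
        change bilin A (φ₂ + ε • ψ) (φ₂ + ε • ψ) = bilin A φ₂ φ₂ + _ + ε ^ 2 * bilin A ψ ψ
        rw [bilin_add_left, bilin_add_right, bilin_add_right, bilin_smul_left, bilin_smul_left,
          bilin_smul_right, bilin_smul_right, bilin_comm hAs ψ φ₂]
        ring
      have e3 : ∑ x, φ₂ x ^ 2 = 1 := hφ₂K
      rw [e1, e2, e3] at hb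
      have e4 : Q φ₂ = lam := rfl
      rw [e4] at hb
      nlinarith [hb]
    have := eq_zero_of_forall_quadratic_nonneg hquad
    linarith
  have heig : ∀ x, ∑ y, (if G.Adj x y then φ₂ y else 0) = lam * φ₂ x := by
    intro x
    have h1 := hpol (Pi.single x 1)
    rw [bilin_single_right] at h1
    have e1 : ∑ y, A y x * φ₂ y = ∑ y, if G.Adj x y then φ₂ y else 0 := by
      refine Finset.sum_congr rfl fun y _ => ?_
      rw [hAs y x]
      simp only [A]
      split_ifs <;> simp
    have e2 : ∑ y, φ₂ y * (Pi.single x (1 : ℝ) : V → ℝ) y = φ₂ x := by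
      rw [Finset.sum_eq_single x]
      · simp
      · intro z _ hz
        simp [hz]
      · intro h'
        exact absurd (mem_univ _) h'
    rw [e1, e2] at h1
    exact h1
  -- positivity by connectivity
  have hφ₂nn : ∀ x, 0 ≤ φ₂ x := fun x => abs_nonneg _
  have hspread : ∀ {a b : V}, G.Adj a b → 0 < φ₂ a → 0 < φ₂ b := by
    intro a b hab ha
    by_contra hb
    have hb0 : φ₂ b = 0 := le_antisymm (not_lt.1 hb) (hφ₂nn b)
    have hsum : ∑ y, (if G.Adj b y then φ₂ y else 0) = 0 := by rw [heig b, hb0, mul_zero]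
    have hterm := (Finset.sum_eq_zero_iff_of_nonneg fun y _ => by
      split_ifs
      · exact hφ₂nn y
      · exact le_rfl).1 hsum a (mem_univ a)
    rw [if_pos hab.symm] at hterm
    exact ha.ne' hterm
  obtain ⟨x₁, hx₁⟩ : ∃ x₁, 0 < φ₂ x₁ := by
    by_contra hnone
    push Not at hnone
    have : ∑ x, φ₂ x ^ 2 = 0 := Finset.sum_eq_zero fun x _ => by
      rw [le_antisymm (hnone x) (hφ₂nn x), zero_pow two_ne_zero]
    rw [show ∑ x, φ₂ x ^ 2 = (1 : ℝ) from hφ₂K] at this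
    exact one_ne_zero this
  have hpos : ∀ x, 0 < φ₂ x := by
    intro x
    obtain ⟨p⟩ := hconn x₁ x
    induction p with
    | nil => exact hx₁
    | cons hadj p ih => exact ih (hspread hadj hx₁)
  obtain ⟨y₁, hy₁⟩ := hnb x₁
  have hlam : 0 < lam := by
    have h1 := heig x₁
    have h2 : φ₂ y₁ ≤ ∑ y, (if G.Adj x₁ y then φ₂ y else 0) := by
      have := Finset.single_le_sum (f := fun y => if G.Adj x₁ y then φ₂ y else 0)
        (fun y _ => by
          split_ifs
          · exact hφ₂nn y
          · exact le_rfl) (mem_univ y₁)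
      simpa [if_pos hy₁] using this
    have h3 : 0 < lam * φ₂ x₁ := by linarith [hpos y₁]
    exact pos_of_mul_pos_left h3 (hφ₂nn x₁)
  exact ⟨lam, φ₂, hlam, hpos, heig⟩

end PerronVector

/-! ### P4a. Spin operators on amplitudes -/

section Spin

variable {Λ : Type*} [LinearOrder Λ] [Fintype Λ]

/-- `S⁺ψ` as the sum of the same-site flips `c†_{x↑} c_{x↓} ψ`. [folklore] -/
theorem spinPlus_mulVec_apply (ψ : Fock (Orb Λ)) (s : Finset (Orb Λ)) :
    (spinPlus *ᵥ ψ) s = ∑ x : Λ, ((creation (orb x 0) * annihilation (orb x 1)) *ᵥ ψ) s := by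
  rw [spinPlus, sum_mulVec, Finset.sum_apply]

/-- `S⁻ = (S⁺)ᴴ = Σ_x c†_{x↓} c_{x↑}`. [folklore] -/
theorem conjTranspose_spinPlus :
    (spinPlus : Matrix (Finset (Orb Λ)) _ ℂ)ᴴ = ∑ x : Λ, creation (orb x 1) * annihilation (orb x 0) := by
  rw [spinPlus, conjTranspose_sum]
  refine Finset.sum_congr rfl fun x _ => ?_
  rw [conjTranspose_mul, creation, creation, conjTranspose_conjTranspose]

/-- `S⁻ψ` as the sum of the same-site flips `c†_{x↓} c_{x↑} ψ`. [folklore] -/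
theorem spinMinus_mulVec_apply (ψ : Fock (Orb Λ)) (s : Finset (Orb Λ)) :
    (spinPlusᴴ *ᵥ ψ) s = ∑ x : Λ, ((creation (orb x 1) * annihilation (orb x 0)) *ᵥ ψ) s := by
  rw [conjTranspose_spinPlus, sum_mulVec, Finset.sum_apply]

/-- `S^z` is diagonal with eigenvalue `(N↑ - N↓)/2`. [folklore] -/
theorem spinZ_mulVec_apply (ψ : Fock (Orb Λ)) (s : Finset (Orb Λ)) :
    (HubbardWave0.spinZ *ᵥ ψ) s = (1 / 2 : ℂ) * ((upCount s : ℂ) - downCount s) * ψ s := by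
  rw [HubbardWave0.spinZ, smul_mulVec, Pi.smul_apply, sum_mulVec, Finset.sum_apply, smul_eq_mul,
    mul_assoc]
  congr 1
  simp only [sub_mulVec, Pi.sub_apply, LiebTwo.numberOp_mulVec, Finset.sum_sub_distrib]
  rw [← Finset.sum_filter, ← Finset.sum_filter, Finset.sum_const, Finset.sum_const, nsmul_eq_mul,
    nsmul_eq_mul, upCount, downCount]
  ring

omit [LinearOrder Λ] [Fintype Λ] in
/-- Two distinct elements exhaust `Fin 2`. [folklore] -/
private theorem fin2_eq_or_eq_of_ne {σ τ : Fin 2} (h : σ ≠ τ) (ρ : Fin 2) : ρ = σ ∨ ρ = τ := by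
  revert σ τ ρ
  decide

/-- A same-site spin flip `c†_{xσ} c_{xτ}` (`σ ≠ τ`) carries no Jordan–Wigner sign on configurations
without double occupancy. [folklore] -/
theorem sameSite_hop_mulVec_apply {σ τ : Fin 2} (hστ : σ ≠ τ) (ψ : Fock (Orb Λ))
    {s : Finset (Orb Λ)} (hs : ¬ HasDoubleOccupancy s) (x : Λ) :
    ((creation (orb x σ) * annihilation (orb x τ)) *ᵥ ψ) s =
      if orb x σ ∈ s then ψ (insert (orb x τ) (s.erase (orb x σ))) else 0 := by
  rw [LiebThm1.creation_mul_annihilation_mulVec_apply]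
  by_cases hσ : orb x σ ∈ s
  · have hτ : orb x τ ∉ s := fun h => hs (hasDoubleOccupancy_of_ne hσ h hστ)
    have hτ' : orb x τ ∉ s.erase (orb x σ) := fun h => hτ (mem_of_mem_erase h)
    have hσ' : orb x σ ∉ s.erase (orb x σ) := Finset.notMem_erase _ _
    have hρ : ∀ ρ : Fin 2, orb x ρ ∉ s.erase (orb x σ) := fun ρ => by
      rcases fin2_eq_or_eq_of_ne hστ ρ with rfl | rfl
      · exact hσ'
      · exact hτ'
    rw [if_pos ⟨hσ, hτ'⟩, if_pos hσ, jwSign_orb_of_empty (hρ 0) (hρ 1) σ,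
      jwSign_orb_of_empty (hρ 0) (hρ 1) τ, ← pow_add, ← two_mul, pow_mul]
    norm_num
  · rw [if_neg fun h => hσ h.1, if_neg hσ]

/-- Same-site spin flips preserve the Gutzwiller (no double occupancy) support condition. [folklore] -/
theorem isGutzwiller_sameSite_hop_mulVec {σ τ : Fin 2} (hστ : σ ≠ τ) {ψ : Fock (Orb Λ)}
    (hψ : IsGutzwiller ψ) (x : Λ) :
    IsGutzwiller ((creation (orb x σ) * annihilation (orb x τ)) *ᵥ ψ) := by
  rintro s ⟨z, hz0, hz1⟩
  rw [LiebThm1.creation_mul_annihilation_mulVec_apply]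
  by_cases hcond : orb x σ ∈ s ∧ orb x τ ∉ s.erase (orb x σ)
  · rw [if_pos hcond]
    have hzρ : ∀ ρ : Fin 2, orb z ρ ∈ s := fun ρ => by
      fin_cases ρ
      · exact hz0
      · exact hz1
    have hzx : z ≠ x := by
      rintro rfl
      refine hcond.2 (Finset.mem_erase.2 ⟨?_, hzρ τ⟩)
      rw [Ne, orb_inj]
      exact fun h => hστ h.2.symm
    have hne : ∀ ρ : Fin 2, orb z ρ ≠ orb x σ := fun ρ h => hzx (orb_inj.1 h).1
    rw [hψ _ ⟨z, Finset.mem_insert_of_mem (Finset.mem_erase.2 ⟨hne 0, hz0⟩),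
      Finset.mem_insert_of_mem (Finset.mem_erase.2 ⟨hne 1, hz1⟩)⟩, mul_zero]
  · rw [if_neg hcond]

/-- `S⁺` preserves the Gutzwiller support condition. [folklore] -/
theorem isGutzwiller_spinPlus_mulVec {ψ : Fock (Orb Λ)} (hψ : IsGutzwiller ψ) :
    IsGutzwiller (spinPlus *ᵥ ψ) := fun s hs => by
  rw [spinPlus_mulVec_apply]
  exact Finset.sum_eq_zero fun x _ => isGutzwiller_sameSite_hop_mulVec zero_ne_one hψ x s hs

/-- `S⁻` preserves the Gutzwiller support condition. [folklore] -/
theorem isGutzwiller_spinMinus_mulVec {ψ : Fock (Orb Λ)} (hψ : IsGutzwiller ψ) :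
    IsGutzwiller (spinPlusᴴ *ᵥ ψ) := fun s hs => by
  rw [spinMinus_mulVec_apply]
  exact Finset.sum_eq_zero fun x _ => isGutzwiller_sameSite_hop_mulVec one_ne_zero hψ x s hs

/-- `S^z` preserves the Gutzwiller support condition. [folklore] -/
theorem isGutzwiller_spinZ_mulVec {ψ : Fock (Orb Λ)} (hψ : IsGutzwiller ψ) :
    IsGutzwiller (HubbardWave0.spinZ *ᵥ ψ) := fun s hs => by
  rw [spinZ_mulVec_apply, hψ s hs, mul_zero]

/-- `S⁺ψ` as the sum of the same-site flips `c†_{x↑} c_{x↓} ψ`. [folklore] -/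
theorem spinPlus_mulVec_apply_of_not_hasDoubleOccupancy (ψ : Fock (Orb Λ)) {s : Finset (Orb Λ)}
    (hs : ¬ HasDoubleOccupancy s) :
    (spinPlus *ᵥ ψ) s = ∑ x : Λ, if orb x 0 ∈ s then ψ (insert (orb x 1) (s.erase (orb x 0))) else 0 := by
  rw [spinPlus_mulVec_apply]
  exact Finset.sum_congr rfl fun x _ => sameSite_hop_mulVec_apply zero_ne_one ψ hs x

/-- `S⁻ψ` as the sum of the same-site flips `c†_{x↓} c_{x↑} ψ`. [folklore] -/
theorem spinMinus_mulVec_apply_of_not_hasDoubleOccupancy (ψ : Fock (Orb Λ)) {s : Finset (Orb Λ)}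
    (hs : ¬ HasDoubleOccupancy s) :
    (spinPlusᴴ *ᵥ ψ) s = ∑ x : Λ, if orb x 1 ∈ s then ψ (insert (orb x 0) (s.erase (orb x 1))) else 0 := by
  rw [spinMinus_mulVec_apply]
  exact Finset.sum_congr rfl fun x _ => sameSite_hop_mulVec_apply one_ne_zero ψ hs x

/-- `S² = S^z S^z + ½ (S⁺ S⁻ + S⁻ S⁺)` applied to a vector. [folklore] -/
theorem spinSq_mulVec (ψ : Fock (Orb Λ)) :
    spinSq *ᵥ ψ = HubbardWave0.spinZ *ᵥ (HubbardWave0.spinZ *ᵥ ψ) +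
      (1 / 2 : ℂ) • (spinPlus *ᵥ (spinPlusᴴ *ᵥ ψ) + spinPlusᴴ *ᵥ (spinPlus *ᵥ ψ)) := by
  simp only [spinSq, add_mulVec, smul_mulVec, mulVec_mulVec]

/-! ### P4b. Spin flips of configurations -/

/-- Flip the spin at site `x` from `σ` to `τ`. [folklore] -/
def flipAt (s : Finset (Orb Λ)) (x : Λ) (σ τ : Fin 2) : Finset (Orb Λ) :=
  insert (orb x τ) (s.erase (orb x σ))

variable {s : Finset (Orb Λ)} {x : Λ} {σ τ : Fin 2}

omit [Fintype Λ] in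
/-- Membership in a spin-flipped configuration, site by site. [folklore] -/
theorem orb_mem_flipAt_iff (hs : ¬ HasDoubleOccupancy s) (hx : orb x σ ∈ s)
    {z : Λ} {ρ : Fin 2} : orb z ρ ∈ flipAt s x σ τ ↔ (z = x ∧ ρ = τ) ∨ (z ≠ x ∧ orb z ρ ∈ s) := by
  rw [flipAt, mem_insert, mem_erase, orb_inj]
  have hne_iff : orb z ρ ≠ orb x σ ↔ ¬ (z = x ∧ ρ = σ) := by rw [Ne, orb_inj]
  rw [hne_iff]
  constructor
  · rintro (h | ⟨h1, h2⟩)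
    · exact Or.inl h
    · refine Or.inr ⟨?_, h2⟩
      rintro rfl
      have : ρ = σ := (eq_spinAt_of_mem hs h2).trans (eq_spinAt_of_mem hs hx).symm
      exact h1 ⟨rfl, this⟩
  · rintro (h | ⟨h1, h2⟩)
    · exact Or.inl h
    · exact Or.inr ⟨fun h => h1 h.1, h2⟩

omit [Fintype Λ] in
/-- A spin flip creates no double occupancy. [folklore] -/
theorem not_hasDoubleOccupancy_flipAt (hs : ¬ HasDoubleOccupancy s) (hx : orb x σ ∈ s) :
    ¬ HasDoubleOccupancy (flipAt s x σ τ) := by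
  rintro ⟨z, h0, h1⟩
  rw [orb_mem_flipAt_iff hs hx] at h0 h1
  rcases h0 with ⟨rfl, e0⟩ | ⟨hz, h0⟩ <;> rcases h1 with ⟨e, e1⟩ | ⟨hz', h1⟩
  · exact absurd (e0.trans e1.symm) (by decide)
  · exact hz' rfl
  · exact hz e
  · exact hs ⟨z, h0, h1⟩

omit [Fintype Λ] in
/-- A spin flip preserves the electron number. [folklore] -/
theorem card_flipAt (hs : ¬ HasDoubleOccupancy s) (hx : orb x σ ∈ s) (hστ : σ ≠ τ) :
    (flipAt s x σ τ).card = s.card := by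
  have hτ : orb x τ ∉ s.erase (orb x σ) := fun h =>
    hs (hasDoubleOccupancy_of_ne hx (mem_of_mem_erase h) hστ)
  rw [flipAt, card_insert_of_notMem hτ, card_erase_of_mem hx]
  have : 0 < s.card := card_pos.2 ⟨_, hx⟩
  omega

/-- A spin flip preserves the holes. [folklore] -/
theorem holes_flipAt (hs : ¬ HasDoubleOccupancy s) (hx : orb x σ ∈ s) :
    holes (flipAt s x σ τ) = holes s := by
  ext z
  rw [mem_holes, mem_holes, orb_mem_flipAt_iff hs hx, orb_mem_flipAt_iff hs hx]
  by_cases hzx : z = x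
  · subst hzx
    have hR : ¬ (orb z 0 ∉ s ∧ orb z 1 ∉ s) := fun h => by
      fin_cases σ
      · exact h.1 hx
      · exact h.2 hx
    have hL : ¬ (¬((z = z ∧ (0 : Fin 2) = τ) ∨ (z ≠ z ∧ orb z 0 ∈ s)) ∧
        ¬((z = z ∧ (1 : Fin 2) = τ) ∨ (z ≠ z ∧ orb z 1 ∈ s))) := by
      rintro ⟨h0, h1⟩
      fin_cases τ
      · exact h0 (Or.inl ⟨rfl, rfl⟩)
      · exact h1 (Or.inl ⟨rfl, rfl⟩)
    exact iff_of_false hL hR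
  · simp [hzx]

/-- A spin flip preserves being a one-hole configuration. [folklore] -/
theorem isOneHole_flipAt_iff (hs : ¬ HasDoubleOccupancy s) (hx : orb x σ ∈ s) (hστ : σ ≠ τ) :
    IsOneHole (flipAt s x σ τ) ↔ IsOneHole s := by
  simp only [IsOneHole, card_flipAt hs hx hστ, not_hasDoubleOccupancy_flipAt hs hx, hs]

omit [Fintype Λ] in
/-- A spin flip preserves the left-counts of electrons. [folklore] -/
theorem nuLeft_flipAt (hx : orb x σ ∈ s) (hτ : orb x τ ∉ s) (y : Λ) :
    nuLeft (flipAt s x σ τ) y = nuLeft s y := by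
  have hτ' : orb x τ ∉ s.erase (orb x σ) := fun h => hτ (mem_of_mem_erase h)
  have hσ' : orb x σ ∉ s.erase (orb x σ) := Finset.notMem_erase _ _
  conv_rhs => rw [← insert_erase hx]
  rw [flipAt, nuLeft_insert hτ', nuLeft_insert hσ']
  rfl

/-- A spin flip preserves the gauge sign. [folklore] -/
theorem gauge_flipAt (hs : ¬ HasDoubleOccupancy s) (hx : orb x σ ∈ s) (hστ : σ ≠ τ) :
    gauge (flipAt s x σ τ) = gauge s := by
  have hτ : orb x τ ∉ s := fun h => hs (hasDoubleOccupancy_of_ne hx h hστ)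
  rw [gauge, gauge, holes_flipAt hs hx]
  exact Finset.prod_congr rfl fun h _ => by rw [nuLeft_flipAt hx hτ]

/-- Flipping an up spin down raises `N↓` by one. [folklore] -/
theorem downCount_flipAt_up (hs : ¬ HasDoubleOccupancy s) (hx : orb x 0 ∈ s) :
    downCount (flipAt s x 0 1) = downCount s + 1 := by
  have hx1 : orb x 1 ∉ s := fun h => hs ⟨x, hx, h⟩
  unfold downCount
  rw [← card_insert_of_notMem (s := univ.filter fun z : Λ => orb z 1 ∈ s) (a := x) (by simp [hx1])]
  congr 1
  ext z
  simp only [mem_filter, mem_univ, true_and, mem_insert]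
  rw [orb_mem_flipAt_iff hs hx]
  constructor
  · rintro (⟨h, -⟩ | ⟨-, h⟩)
    · exact Or.inl h
    · exact Or.inr h
  · rintro (h | h)
    · exact Or.inl ⟨h, rfl⟩
    · by_cases hzx : z = x
      · exact Or.inl ⟨hzx, rfl⟩
      · exact Or.inr ⟨hzx, h⟩

/-- Flipping a down spin up lowers `N↓` by one. [folklore] -/
theorem downCount_flipAt_down (hs : ¬ HasDoubleOccupancy s) (hx : orb x 1 ∈ s) :
    downCount (flipAt s x 1 0) + 1 = downCount s := by
  unfold downCount
  have hmem : x ∈ univ.filter fun z : Λ => orb z 1 ∈ s := by simp [hx]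
  rw [← card_erase_add_one hmem]
  congr 2
  ext z
  simp only [mem_filter, mem_univ, true_and, mem_erase]
  rw [orb_mem_flipAt_iff hs hx]
  constructor
  · rintro (⟨-, h⟩ | ⟨h1, h2⟩)
    · exact absurd h (by decide)
    · exact ⟨h1, h2⟩
  · rintro ⟨h1, h2⟩
    exact Or.inr ⟨h1, h2⟩

end Spin

/-! ### P4c. The ferromagnetic multiplet: Dicke-type states and their total spin -/

section Dicke

variable {Λ : Type*} [LinearOrder Λ] [Fintype Λ]

/-- The states `Φ_{c,k}`: on a one-hole configuration with `k` down spins the amplitude is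
`gauge(s) · c(hole)`, independent of the spin arrangement; zero elsewhere. For `c = ` the Perron
vector of `G` these are the Nagaoka ground states `(S⁻)^k Φ_↑` (up to normalisation).
[cite: Tasaki1989, Theorem] -/
def dicke (c : Λ → ℂ) (k : ℕ) : Fock (Orb Λ) := fun s =>
  if IsOneHole s ∧ downCount s = k then gauge s * ∑ h ∈ holes s, c h else 0

variable {c : Λ → ℂ} {k : ℕ} {s : Finset (Orb Λ)} {x : Λ} {σ τ : Fin 2}

/-- Value of `Φ_{c,k}` on its support. [folklore] -/
theorem dicke_apply_of (h : IsOneHole s ∧ downCount s = k) :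
    dicke c k s = gauge s * ∑ h ∈ holes s, c h := if_pos h

/-- Value of `Φ_{c,k}` on its support. [folklore] -/
theorem dicke_apply_of_not (h : ¬ (IsOneHole s ∧ downCount s = k)) : dicke c k s = 0 := if_neg h

/-- `Φ_{c,k}` is a Gutzwiller vector. [folklore] -/
theorem isGutzwiller_dicke (c : Λ → ℂ) (k : ℕ) : IsGutzwiller (dicke c k) :=
  fun _ hs => if_neg fun h => h.1.2 hs

/-- `Φ_{c,k}` lies in the `(|Λ| - 1)`-particle sector. [folklore] -/
theorem isNParticle_dicke (c : Λ → ℂ) (k : ℕ) : IsNParticle (Fintype.card Λ - 1) (dicke c k) :=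
  fun _ hs => if_neg fun h => hs h.1.1

/-- Value of `Φ_{c,k}` on a spin-flipped configuration: only the down-spin count changes. [folklore] -/
theorem dicke_flipAt (hs : ¬ HasDoubleOccupancy s) (hx : orb x σ ∈ s) (hστ : σ ≠ τ) (c : Λ → ℂ)
    (k : ℕ) :
    dicke c k (flipAt s x σ τ) =
      if IsOneHole s ∧ downCount (flipAt s x σ τ) = k then gauge s * ∑ h ∈ holes s, c h else 0 := by
  unfold dicke
  simp only [isOneHole_flipAt_iff hs hx hστ, gauge_flipAt hs hx hστ, holes_flipAt hs hx]

/-- Lowering: `S⁻ Φ_k = (k+1) Φ_{k+1}`. [folklore] -/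
theorem spinMinus_mulVec_dicke (c : Λ → ℂ) (k : ℕ) :
    spinPlusᴴ *ᵥ dicke c k = ((k + 1 : ℕ) : ℂ) • dicke c (k + 1) := by
  funext s
  rw [Pi.smul_apply, smul_eq_mul]
  by_cases hs : HasDoubleOccupancy s
  · rw [isGutzwiller_spinMinus_mulVec (isGutzwiller_dicke c k) s hs, isGutzwiller_dicke c _ s hs,
      mul_zero]
  rw [spinMinus_mulVec_apply_of_not_hasDoubleOccupancy _ hs]
  have hflip : ∀ x, orb x 1 ∈ s → dicke c k (insert (orb x 0) (s.erase (orb x 1))) =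
      if IsOneHole s ∧ downCount s = k + 1 then gauge s * ∑ h ∈ holes s, c h else 0 := by
    intro x hx
    have e := dicke_flipAt hs hx one_ne_zero c k
    have hd := downCount_flipAt_down hs hx
    rw [flipAt] at e hd
    rw [e]
    by_cases hk : IsOneHole s ∧ downCount s = k + 1
    · rw [if_pos hk, if_pos ⟨hk.1, by omega⟩]
    · rw [if_neg hk, if_neg fun h => hk ⟨h.1, by omega⟩]
  rw [Finset.sum_congr rfl fun x _ => show (if orb x 1 ∈ s then
      dicke c k (insert (orb x 0) (s.erase (orb x 1))) else 0) =
      if orb x 1 ∈ s then (if IsOneHole s ∧ downCount s = k + 1 then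
        gauge s * ∑ h ∈ holes s, c h else 0) else 0 by
    by_cases hx : orb x 1 ∈ s
    · rw [if_pos hx, if_pos hx, hflip x hx]
    · rw [if_neg hx, if_neg hx]]
  rw [← Finset.sum_filter, Finset.sum_const, nsmul_eq_mul]
  by_cases hk : IsOneHole s ∧ downCount s = k + 1
  · rw [if_pos hk, dicke_apply_of hk, show (univ.filter fun x : Λ => orb x 1 ∈ s).card = downCount s
      from rfl, hk.2]
  · rw [if_neg hk, dicke_apply_of_not hk, mul_zero, mul_zero]

/-- Raising: `S⁺ Φ_{k+1} = (N - k) Φ_k`. [folklore] -/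
theorem spinPlus_mulVec_dicke_succ (c : Λ → ℂ) (k : ℕ) :
    spinPlus *ᵥ dicke c (k + 1) = (((Fintype.card Λ - 1 : ℕ) : ℂ) - k) • dicke c k := by
  funext s
  rw [Pi.smul_apply, smul_eq_mul]
  by_cases hs : HasDoubleOccupancy s
  · rw [isGutzwiller_spinPlus_mulVec (isGutzwiller_dicke c _) s hs, isGutzwiller_dicke c _ s hs,
      mul_zero]
  rw [spinPlus_mulVec_apply_of_not_hasDoubleOccupancy _ hs]
  have hflip : ∀ x, orb x 0 ∈ s → dicke c (k + 1) (insert (orb x 1) (s.erase (orb x 0))) =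
      if IsOneHole s ∧ downCount s = k then gauge s * ∑ h ∈ holes s, c h else 0 := by
    intro x hx
    have e := dicke_flipAt hs hx zero_ne_one c (k + 1)
    have hd := downCount_flipAt_up hs hx
    rw [flipAt] at e hd
    rw [e]
    by_cases hk : IsOneHole s ∧ downCount s = k
    · rw [if_pos hk, if_pos ⟨hk.1, by omega⟩]
    · rw [if_neg hk, if_neg fun h => hk ⟨h.1, by omega⟩]
  rw [Finset.sum_congr rfl fun x _ => show (if orb x 0 ∈ s then
      dicke c (k + 1) (insert (orb x 1) (s.erase (orb x 0))) else 0) =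
      if orb x 0 ∈ s then (if IsOneHole s ∧ downCount s = k then
        gauge s * ∑ h ∈ holes s, c h else 0) else 0 by
    by_cases hx : orb x 0 ∈ s
    · rw [if_pos hx, if_pos hx, hflip x hx]
    · rw [if_neg hx, if_neg hx]]
  rw [← Finset.sum_filter, Finset.sum_const, nsmul_eq_mul]
  by_cases hk : IsOneHole s ∧ downCount s = k
  · rw [if_pos hk, dicke_apply_of hk, show (univ.filter fun x : Λ => orb x 0 ∈ s).card = upCount s
      from rfl]
    have h1 := upCount_add_downCount hk.1.2
    rw [hk.1.1, hk.2] at h1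
    have h2 : (upCount s : ℂ) = ((Fintype.card Λ - 1 : ℕ) : ℂ) - k := by
      rw [← h1, Nat.cast_add]
      ring
    rw [h2]
  · rw [if_neg hk, dicke_apply_of_not hk, mul_zero, mul_zero]

/-- Raising annihilates the all-up states: `S⁺ Φ_0 = 0`. [folklore] -/
theorem spinPlus_mulVec_dicke_zero (c : Λ → ℂ) : spinPlus *ᵥ dicke c 0 = 0 := by
  funext s
  rw [Pi.zero_apply]
  by_cases hs : HasDoubleOccupancy s
  · exact isGutzwiller_spinPlus_mulVec (isGutzwiller_dicke c _) s hs
  rw [spinPlus_mulVec_apply_of_not_hasDoubleOccupancy _ hs]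
  refine Finset.sum_eq_zero fun x _ => ?_
  by_cases hx : orb x 0 ∈ s
  · rw [if_pos hx]
    have e := dicke_flipAt hs hx zero_ne_one c 0
    have hd := downCount_flipAt_up hs hx
    rw [flipAt] at e hd
    rw [e, if_neg fun h => by omega]
  · rw [if_neg hx]

/-- `S^z Φ_k = ((N - 2k)/2) Φ_k`. [folklore] -/
theorem spinZ_mulVec_dicke (c : Λ → ℂ) (k : ℕ) :
    HubbardWave0.spinZ *ᵥ dicke c k =
      ((1 / 2 : ℂ) * (((Fintype.card Λ - 1 : ℕ) : ℂ) - 2 * k)) • dicke c k := by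
  funext s
  rw [Pi.smul_apply, smul_eq_mul, spinZ_mulVec_apply]
  by_cases hk : IsOneHole s ∧ downCount s = k
  · have h1 := upCount_add_downCount hk.1.2
    rw [hk.1.1, hk.2] at h1
    have h2 : (upCount s : ℂ) = ((Fintype.card Λ - 1 : ℕ) : ℂ) - k := by
      rw [← h1, Nat.cast_add]
      ring
    rw [h2, hk.2]
    ring
  · rw [dicke_apply_of_not hk, mul_zero, mul_zero]

/-- **Total spin of the multiplet.** `S² Φ_k = S(S+1) Φ_k` with `S = N/2`, `N = |Λ| - 1`.
[cite: Tasaki1989, Theorem] -/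
theorem spinSq_mulVec_dicke (c : Λ → ℂ) (k : ℕ) :
    spinSq *ᵥ dicke c k =
      ((((Fintype.card Λ - 1 : ℕ) : ℂ) / 2) * (((Fintype.card Λ - 1 : ℕ) : ℂ) / 2 + 1)) •
        dicke c k := by
  rw [spinSq_mulVec, spinMinus_mulVec_dicke, mulVec_smul, spinPlus_mulVec_dicke_succ,
    spinZ_mulVec_dicke, mulVec_smul, spinZ_mulVec_dicke, smul_smul, smul_smul]
  cases k with
  | zero =>
    rw [spinPlus_mulVec_dicke_zero, mulVec_zero, add_zero, smul_smul, ← add_smul]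
    congr 1
    push_cast
    ring
  | succ j =>
    rw [spinPlus_mulVec_dicke_succ, mulVec_smul, spinMinus_mulVec_dicke, smul_smul, ← add_smul,
      smul_smul, ← add_smul]
    congr 1
    push_cast
    ring

end Dicke

/-! ### P5a. Canonical one-hole configurations, hop sums, and the hole-hop graph -/

section Assembly

variable {Λ : Type*} [LinearOrder Λ] [Fintype Λ]

/-- The one-hole configuration with hole `h₀` and down spins exactly on `D` (up elsewhere). [folklore] -/
def cfg (h₀ : Λ) (D : Finset Λ) : Finset (Orb Λ) :=
  (univ.erase h₀).image fun z => orb z (if z ∈ D then 1 else 0)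

variable {h₀ : Λ} {D : Finset Λ}

/-- Membership in the canonical configuration `cfg h₀ D`. [folklore] -/
theorem orb_mem_cfg_iff {z : Λ} {ρ : Fin 2} :
    orb z ρ ∈ cfg h₀ D ↔ z ≠ h₀ ∧ ρ = if z ∈ D then 1 else 0 := by
  simp only [cfg, mem_image, mem_erase, mem_univ, and_true, orb_inj]
  constructor
  · rintro ⟨w, hw, rfl, h⟩
    exact ⟨hw, h.symm⟩
  · rintro ⟨hz, h⟩
    exact ⟨z, hz, rfl, h.symm⟩

/-- `cfg h₀ D` has no double occupancy. [folklore] -/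
theorem not_hasDoubleOccupancy_cfg : ¬ HasDoubleOccupancy (cfg h₀ D) := by
  rintro ⟨z, h0, h1⟩
  rw [orb_mem_cfg_iff] at h0 h1
  have := h0.2.trans h1.2.symm
  exact absurd this (by decide)

/-- `cfg h₀ D` has `|Λ| - 1` electrons. [folklore] -/
theorem card_cfg : (cfg h₀ D).card = Fintype.card Λ - 1 := by
  rw [cfg, Finset.card_image_of_injective, Finset.card_erase_of_mem (mem_univ _), Finset.card_univ]
  intro a b hab
  exact (orb_inj.1 hab).1

/-- `cfg h₀ D` is a one-hole configuration. [folklore] -/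
theorem isOneHole_cfg : IsOneHole (cfg h₀ D) := ⟨card_cfg, not_hasDoubleOccupancy_cfg⟩

/-- The hole of `cfg h₀ D` is `h₀`. [folklore] -/
theorem holes_cfg : holes (cfg h₀ D) = {h₀} := by
  ext z
  rw [mem_holes, orb_mem_cfg_iff, orb_mem_cfg_iff, mem_singleton]
  constructor
  · rintro ⟨h0, h1⟩
    by_contra hz
    by_cases hzD : z ∈ D
    · exact h1 ⟨hz, by rw [if_pos hzD]⟩
    · exact h0 ⟨hz, by rw [if_neg hzD]⟩
  · rintro rfl
    exact ⟨fun h => h.1 rfl, fun h => h.1 rfl⟩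

/-- `cfg h₀ D` has `|D|` down spins. [folklore] -/
theorem downCount_cfg (hD : D ⊆ univ.erase h₀) : downCount (cfg h₀ D) = D.card := by
  unfold downCount
  congr 1
  ext z
  rw [mem_filter, orb_mem_cfg_iff]
  constructor
  · rintro ⟨-, -, h⟩
    by_contra hzD
    rw [if_neg hzD] at h
    exact absurd h (by decide)
  · intro hzD
    have hz : z ≠ h₀ := (mem_erase.1 (hD hzD)).1
    exact ⟨mem_univ _, hz, by rw [if_pos hzD]⟩

/-- Every `S^z` sector of one-hole configurations with a prescribed hole is nonempty. [folklore] -/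
theorem exists_isOneHole_downCount_eq (h₀ : Λ) {k : ℕ} (hk : k ≤ Fintype.card Λ - 1) :
    ∃ s : Finset (Orb Λ), IsOneHole s ∧ holes s = {h₀} ∧ downCount s = k := by
  have hcard : k ≤ (univ.erase h₀).card := by
    rwa [Finset.card_erase_of_mem (mem_univ _), Finset.card_univ]
  obtain ⟨D, hD, hDk⟩ := Finset.exists_subset_card_eq hcard
  exact ⟨cfg h₀ D, isOneHole_cfg, holes_cfg, (downCount_cfg hD).trans hDk⟩

variable (G : SimpleGraph Λ)

/-- The hole of the endpoint of a hop is adjacent to the hole of its start. [folklore] -/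
theorem adj_of_isHoleHop {a b : Finset (Orb Λ)} (ha : ¬ HasDoubleOccupancy a) {x y : Λ}
    (hx : holes a = {x}) (hy : holes b = {y}) (hhop : IsHoleHop G a b) : G.Adj x y := by
  obtain ⟨z, hadj, rfl⟩ := (isHoleHop_iff G ha hx).1 hhop
  rw [holes_move ha hx hadj.ne.symm] at hy
  rw [← Finset.singleton_injective hy]
  exact hadj

/-- A walk in the hole-hop graph projects to a walk of the hole in `G`. [folklore] -/
theorem reachable_of_holeHopGraph_walk (hΛ : 0 < Fintype.card Λ) {a b : OneHoleConfig Λ}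
    (p : (holeHopGraph G).Walk a b) {x y : Λ} (hx : holes a.1 = {x}) (hy : holes b.1 = {y}) :
    G.Reachable x y := by
  induction p generalizing x with
  | nil =>
    rw [hx] at hy
    rw [Finset.singleton_injective hy]
  | @cons u v w hadj p ih =>
    obtain ⟨z, hz⟩ := IsOneHole.exists_holes_eq (s := v.1) ⟨v.2.1, v.2.2⟩ hΛ
    have h1 : G.Adj x z := by
      rw [holeHopGraph, SimpleGraph.fromRel_adj] at hadj
      rcases hadj.2 with h | h
      · exact adj_of_isHoleHop G u.2.2 hx hz h
      · exact (adj_of_isHoleHop G v.2.2 hz hx h).symm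
    exact h1.reachable.trans (ih hz hy)

/-- Tasaki's connectivity condition implies that `G` is connected. [folklore] -/
theorem preconnected_of_satisfiesConnectivity (hΛ : 0 < Fintype.card Λ)
    (hconn : SatisfiesConnectivity G) : G.Preconnected := by
  intro x y
  let a : OneHoleConfig Λ := ⟨cfg x ∅, isOneHole_cfg.1, isOneHole_cfg.2⟩
  let b : OneHoleConfig Λ := ⟨cfg y ∅, isOneHole_cfg.1, isOneHole_cfg.2⟩
  have hup : upCount a.1 = upCount b.1 := by
    have ha := upCount_add_downCount (s := cfg x ∅) not_hasDoubleOccupancy_cfg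
    have hb := upCount_add_downCount (s := cfg y ∅) not_hasDoubleOccupancy_cfg
    rw [downCount_cfg (empty_subset _), card_cfg] at ha hb
    change upCount (cfg x ∅) = upCount (cfg y ∅)
    rw [Finset.card_empty, add_zero] at ha hb
    rw [ha, hb]
  obtain ⟨p⟩ := hconn a b hup
  exact reachable_of_holeHopGraph_walk G hΛ p holes_cfg holes_cfg

/-- Under the connectivity condition with `|Λ| ≥ 2`, every site has a neighbour. [folklore] -/
theorem exists_adj_of_satisfiesConnectivity (hΛ : 2 ≤ Fintype.card Λ)
    (hconn : SatisfiesConnectivity G) (x : Λ) : ∃ y, G.Adj x y := by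
  have : Nontrivial Λ := Fintype.one_lt_card_iff_nontrivial.1 hΛ
  obtain ⟨y, hy⟩ := exists_ne x
  obtain ⟨p⟩ := preconnected_of_satisfiesConnectivity G (by omega) hconn x y
  cases p with
  | nil => exact absurd rfl hy
  | cons hadj _ => exact ⟨_, hadj⟩

variable [DecidableRel G.Adj]

set_option synthInstance.maxSize 2048 in
/-- Hole hops are decidable (a finite existential). [folklore] -/
instance instDecidableIsHoleHop (s s' : Finset (Orb Λ)) : Decidable (IsHoleHop G s s') := by
  unfold IsHoleHop
  infer_instance

/-- Sums over the hop-neighbours of a one-hole configuration are sums over the neighbours of its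
hole. [folklore] -/
theorem sum_isHoleHop_eq {M : Type*} [AddCommMonoid M] {s : Finset (Orb Λ)}
    (hs : ¬ HasDoubleOccupancy s) {h : Λ} (hh : holes s = {h}) (F : Finset (Orb Λ) → M) :
    (∑ s', if IsHoleHop G s s' then F s' else 0) = ∑ y ∈ univ.filter (G.Adj h ·), F (move s y h) := by
  rw [← Finset.sum_filter]
  have hset : (univ.filter fun s' => IsHoleHop G s s') =
      (univ.filter (G.Adj h ·)).image fun y => move s y h := by
    ext s'
    simp only [mem_filter, mem_univ, true_and, mem_image]
    constructor
    · intro hhop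
      obtain ⟨y, hadj, rfl⟩ := (isHoleHop_iff G hs hh).1 hhop
      exact ⟨y, hadj, rfl⟩
    · rintro ⟨y, hadj, rfl⟩
      exact (isHoleHop_iff G hs hh).2 ⟨y, hadj, rfl⟩
  rw [hset, Finset.sum_image]
  intro a ha b hb hab
  have ha' : G.Adj h a := by simpa using ha
  have hb' : G.Adj h b := by simpa using hb
  exact move_injective hs hh ha'.ne.symm hb'.ne.symm hab

end Assembly

/-! ### P5b. Spectral analysis of the one-hole `U = ∞` model -/

section Spectral

variable {Λ : Type*} [LinearOrder Λ] [Fintype Λ] (G : SimpleGraph Λ) [DecidableRel G.Adj]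
variable {lam : ℝ} {g : Λ → ℝ}

/-- `⟨ψ, ψ⟩ = Σ |ψ_i|²`. [folklore] -/
theorem star_dotProduct_self_eq {ι : Type*} [Fintype ι] (ψ : ι → ℂ) :
    star ψ ⬝ᵥ ψ = ((∑ i, Complex.normSq (ψ i) : ℝ) : ℂ) := by
  rw [dotProduct]
  push_cast
  exact Finset.sum_congr rfl fun i _ => by rw [Pi.star_apply, Complex.normSq_eq_conj_mul_self]; rfl

/-- The gauge sign has modulus one. [folklore] -/
theorem normSq_gauge_mul (s : Finset (Orb Λ)) (z : ℂ) :
    Complex.normSq (gauge s * z) = Complex.normSq z := by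
  rw [Complex.normSq_mul, normSq_gauge, one_mul]

/-- **The ferromagnetic states are eigenvectors.** With `g` a `λ`-eigenvector of the adjacency
matrix, `H Φ_{g,k} = tλ Φ_{g,k}` for every `k`. [cite: Tasaki1989, Theorem] -/
theorem hubbardInfty_mulVec_dicke (heig : ∀ x, ∑ y, (if G.Adj x y then g y else 0) = lam * g x)
    (hΛ : 0 < Fintype.card Λ) (t : ℝ) (k : ℕ) :
    hubbardInfty G t *ᵥ dicke (fun x => (g x : ℂ)) k =
      ((t * lam : ℝ) : ℂ) • dicke (fun x => (g x : ℂ)) k := by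
  funext s
  rw [Pi.smul_apply, smul_eq_mul]
  by_cases hs : IsOneHole s
  · obtain ⟨h, hh⟩ := hs.exists_holes_eq hΛ
    rw [hubbardInfty_mulVec_of_holes_eq G t (isGutzwiller_dicke _ _) hs.2 hh]
    have hterm : ∀ y ∈ univ.filter (G.Adj h ·),
        gauge (move s y h) * dicke (fun x => (g x : ℂ)) k (move s y h) =
          if downCount s = k then (g y : ℂ) else 0 := by
      intro y hy
      have hy' : G.Adj h y := by simpa using hy
      have hyh : y ≠ h := hy'.ne.symm
      unfold dicke
      rw [downCount_move hs.2 hh hyh, holes_move hs.2 hh hyh, sum_singleton]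
      by_cases hk : downCount s = k
      · rw [if_pos ⟨isOneHole_move hs hh hyh, hk⟩, if_pos hk, ← mul_assoc, gauge_mul_self, one_mul]
      · rw [if_neg fun h' => hk h'.2, if_neg hk, mul_zero]
    rw [Finset.sum_congr rfl hterm]
    unfold dicke
    rw [hh, sum_singleton]
    by_cases hk : downCount s = k
    · simp only [hk, if_true, and_true, if_pos hs]
      have h1 := heig h
      rw [← Finset.sum_filter] at h1
      have hc : (∑ y ∈ univ.filter (G.Adj h ·), (g y : ℂ)) = ((lam * g h : ℝ) : ℂ) := by
        rw [← h1]
        push_cast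
        rfl
      rw [hc]
      push_cast
      ring
    · simp only [hk, if_false, and_false, Finset.sum_const_zero, mul_zero]
  · rw [hubbardInfty_mulVec_of_not_isOneHole G t (isNParticle_dicke _ _) (isGutzwiller_dicke _ _) hs,
      dicke_apply_of_not fun h => hs h.1, mul_zero]

/-- The hop matrix `B` on configurations: `1` between a one-hole configuration and each of its hop
neighbours, `0` otherwise. [folklore] -/
def hopMatrix (s s' : Finset (Orb Λ)) : ℝ := if IsOneHole s ∧ IsHoleHop G s s' then 1 else 0

/-- The hop matrix is entrywise nonnegative. [folklore] -/
theorem hopMatrix_nonneg (s s' : Finset (Orb Λ)) : 0 ≤ hopMatrix G s s' := by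
  unfold hopMatrix
  split_ifs <;> norm_num

omit [DecidableRel G.Adj] in
/-- Hops between one-hole configurations are reversible (bundled form). [folklore] -/
theorem isOneHole_and_isHoleHop_symm (hΛ : 0 < Fintype.card Λ) {s s' : Finset (Orb Λ)}
    (h : IsOneHole s ∧ IsHoleHop G s s') : IsOneHole s' ∧ IsHoleHop G s' s := by
  obtain ⟨x, hx⟩ := h.1.exists_holes_eq hΛ
  obtain ⟨y, hadj, rfl⟩ := (isHoleHop_iff G h.1.2 hx).1 h.2
  exact ⟨isOneHole_move h.1 hx hadj.ne.symm, isHoleHop_symm_of_holes_eq G h.1.2 hx h.2⟩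

/-- The hop matrix is symmetric. [folklore] -/
theorem hopMatrix_symm (hΛ : 0 < Fintype.card Λ) (s s' : Finset (Orb Λ)) :
    hopMatrix G s s' = hopMatrix G s' s := by
  unfold hopMatrix
  by_cases h : IsOneHole s ∧ IsHoleHop G s s'
  · rw [if_pos h, if_pos (isOneHole_and_isHoleHop_symm G hΛ h)]
  · by_cases h' : IsOneHole s' ∧ IsHoleHop G s' s
    · exact absurd (isOneHole_and_isHoleHop_symm G hΛ h') h
    · rw [if_neg h, if_neg h']

/-- The Perron weight lifted to configurations: `g(hole)` on one-hole configurations, `1` (any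
positive junk value) elsewhere. [folklore] -/
def liftWeight (g : Λ → ℝ) (s : Finset (Orb Λ)) : ℝ := if IsOneHole s then ∑ h ∈ holes s, g h else 1

/-- The lifted weight of a one-hole configuration is `g(hole)`. [folklore] -/
theorem liftWeight_eq {s : Finset (Orb Λ)} (hs : IsOneHole s) {h : Λ} (hh : holes s = {h}) :
    liftWeight g s = g h := by
  rw [liftWeight, if_pos hs, hh, sum_singleton]

/-- The lifted weight is strictly positive. [folklore] -/
theorem liftWeight_pos (hg : ∀ x, 0 < g x) (hΛ : 0 < Fintype.card Λ) (s : Finset (Orb Λ)) :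
    0 < liftWeight g s := by
  by_cases hs : IsOneHole s
  · obtain ⟨h, hh⟩ := hs.exists_holes_eq hΛ
    rw [liftWeight_eq hs hh]
    exact hg h
  · rw [liftWeight, if_neg hs]
    exact one_pos

/-- The lifted Perron weight is a `λ`-subeigenvector of the hop matrix (an eigenvector on the one-hole configurations). [folklore] -/
theorem hopMatrix_subeigen (heig : ∀ x, ∑ y, (if G.Adj x y then g y else 0) = lam * g x)
    (hlam : 0 < lam) (hΛ : 0 < Fintype.card Λ) (s : Finset (Orb Λ)) :
    ∑ s', hopMatrix G s s' * liftWeight g s' ≤ lam * liftWeight g s := by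
  by_cases hs : IsOneHole s
  · obtain ⟨h, hh⟩ := hs.exists_holes_eq hΛ
    have e1 : ∀ s', hopMatrix G s s' * liftWeight g s' =
        if IsHoleHop G s s' then liftWeight g s' else 0 := fun s' => by
      unfold hopMatrix
      by_cases h' : IsHoleHop G s s'
      · rw [if_pos ⟨hs, h'⟩, if_pos h', one_mul]
      · rw [if_neg fun h'' => h' h''.2, if_neg h', zero_mul]
    rw [Finset.sum_congr rfl fun s' _ => e1 s', sum_isHoleHop_eq G hs.2 hh]
    have e2 : ∀ y ∈ univ.filter (G.Adj h ·), liftWeight g (move s y h) = g y := fun y hy => by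
      have hy' : G.Adj h y := by simpa using hy
      rw [liftWeight_eq (isOneHole_move hs hh hy'.ne.symm) (holes_move hs.2 hh hy'.ne.symm)]
    rw [Finset.sum_congr rfl e2, liftWeight_eq hs hh, ← heig h, Finset.sum_filter]
  · have e : ∀ s', hopMatrix G s s' = 0 := fun s' => if_neg fun h => hs h.1
    simp only [e, zero_mul, Finset.sum_const_zero, liftWeight, if_neg hs, mul_one]
    exact hlam.le

/-- **The quadratic form of `H` in the gauged basis**: `⟨ψ, Hψ⟩ = t Σ_{s,s'} B_{ss'} conj(f_s) f_{s'}`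
with `f = gauge · ψ`. [cite: Tasaki1989, Theorem] -/
theorem expect_hubbardInfty (t : ℝ) {ψ : Fock (Orb Λ)} (hN : IsNParticle (Fintype.card Λ - 1) ψ)
    (hG : IsGutzwiller ψ) (hΛ : 0 < Fintype.card Λ) :
    expect (hubbardInfty G t) ψ = (t : ℂ) * ∑ s, ∑ s', (hopMatrix G s s' : ℂ) *
      (starRingEnd ℂ (gauge s * ψ s) * (gauge s' * ψ s')) := by
  unfold expect
  rw [dotProduct, Finset.mul_sum]
  refine Finset.sum_congr rfl fun s _ => ?_
  rw [Pi.star_apply]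
  by_cases hs : IsOneHole s
  · obtain ⟨h, hh⟩ := hs.exists_holes_eq hΛ
    rw [hubbardInfty_mulVec_of_holes_eq G t hG hs.2 hh]
    have e1 : ∀ s', (hopMatrix G s s' : ℂ) * (starRingEnd ℂ (gauge s * ψ s) * (gauge s' * ψ s')) =
        if IsHoleHop G s s' then starRingEnd ℂ (gauge s * ψ s) * (gauge s' * ψ s') else 0 := by
      intro s'
      unfold hopMatrix
      by_cases h' : IsHoleHop G s s'
      · rw [if_pos ⟨hs, h'⟩, if_pos h']
        push_cast
        rw [one_mul]
      · rw [if_neg fun h'' => h' h''.2, if_neg h']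
        push_cast
        rw [zero_mul]
    rw [Finset.sum_congr rfl fun s' _ => e1 s', sum_isHoleHop_eq G hs.2 hh, Finset.mul_sum,
      Finset.mul_sum, Finset.mul_sum]
    refine Finset.sum_congr rfl fun y _ => ?_
    rw [map_mul]
    simp only [starRingEnd_apply, star_gauge]
    ring
  · rw [hubbardInfty_mulVec_of_not_isOneHole G t hN hG hs, mul_zero]
    have e : ∀ s', (hopMatrix G s s' : ℂ) = 0 := fun s' => by
      unfold hopMatrix
      rw [if_neg fun h => hs h.1]
      push_cast
      rfl
    simp only [e, zero_mul, Finset.sum_const_zero, mul_zero]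

/-- **Variational lower bound.** For `t < 0`, `Re ⟨ψ, Hψ⟩ ≥ tλ ‖ψ‖²` on the one-hole Gutzwiller
sector. [cite: Tasaki1989, Theorem] -/
theorem mul_norm_le_expect_re (heig : ∀ x, ∑ y, (if G.Adj x y then g y else 0) = lam * g x)
    (hlam : 0 < lam) (hg : ∀ x, 0 < g x) (hΛ : 0 < Fintype.card Λ) {t : ℝ} (ht : t < 0)
    {ψ : Fock (Orb Λ)} (hN : IsNParticle (Fintype.card Λ - 1) ψ) (hG : IsGutzwiller ψ) :
    t * lam * ∑ s, Complex.normSq (ψ s) ≤ (expect (hubbardInfty G t) ψ).re := by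
  rw [expect_hubbardInfty G t hN hG hΛ, Complex.re_ofReal_mul]
  obtain ⟨hle, -⟩ := re_quadratic_le_of_subeigenvector (hopMatrix G) (hopMatrix_nonneg G)
    (hopMatrix_symm G hΛ) (liftWeight g) (liftWeight_pos hg hΛ) lam
    (hopMatrix_subeigen G heig hlam hΛ) (fun s => gauge s * ψ s)
  simp only [normSq_gauge_mul] at hle
  have := mul_le_mul_of_nonpos_left hle ht.le
  linarith

/-- **Equality case.** A one-hole Gutzwiller eigenvector with the eigenvalue `tλ` has `gauge · ψ`
proportional to the lifted Perron weight across every hop. [cite: Tasaki1989, Theorem] -/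
theorem ratio_of_eigenvector (heig : ∀ x, ∑ y, (if G.Adj x y then g y else 0) = lam * g x)
    (hlam : 0 < lam) (hg : ∀ x, 0 < g x) (hΛ : 0 < Fintype.card Λ) {t : ℝ} (ht : t < 0)
    {ψ : Fock (Orb Λ)} (hN : IsNParticle (Fintype.card Λ - 1) ψ) (hG : IsGutzwiller ψ)
    (heq : hubbardInfty G t *ᵥ ψ = ((t * lam : ℝ) : ℂ) • ψ) :
    ∀ s s', hopMatrix G s s' ≠ 0 →
      gauge s * ψ s * liftWeight g s' = gauge s' * ψ s' * liftWeight g s := by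
  obtain ⟨-, hcase⟩ := re_quadratic_le_of_subeigenvector (hopMatrix G) (hopMatrix_nonneg G)
    (hopMatrix_symm G hΛ) (liftWeight g) (liftWeight_pos hg hΛ) lam
    (hopMatrix_subeigen G heig hlam hΛ) (fun s => gauge s * ψ s)
  apply hcase
  have h1 : expect (hubbardInfty G t) ψ = ((t * lam : ℝ) : ℂ) * star ψ ⬝ᵥ ψ := by
    unfold expect
    rw [heq, dotProduct_smul, smul_eq_mul]
  rw [expect_hubbardInfty G t hN hG hΛ, star_dotProduct_self_eq] at h1
  have ht0 : (t : ℂ) ≠ 0 := by exact_mod_cast ht.ne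
  have h2 : (∑ s, ∑ s', (hopMatrix G s s' : ℂ) * (starRingEnd ℂ (gauge s * ψ s) * (gauge s' * ψ s'))) =
      ((lam * ∑ s, Complex.normSq (ψ s) : ℝ) : ℂ) := by
    apply mul_left_cancel₀ ht0
    rw [h1]
    push_cast
    ring
  rw [h2]
  simp only [normSq_gauge_mul, Complex.ofReal_re]

/-- Proportionality propagates along walks of the hole-hop graph. [folklore] -/
theorem ratio_of_walk (hg : ∀ x, 0 < g x) (hΛ : 0 < Fintype.card Λ) {f : Finset (Orb Λ) → ℂ}
    (hratio : ∀ s s', hopMatrix G s s' ≠ 0 → f s * liftWeight g s' = f s' * liftWeight g s)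
    {a b : OneHoleConfig Λ} (p : (holeHopGraph G).Walk a b) :
    f a.1 * liftWeight g b.1 = f b.1 * liftWeight g a.1 := by
  induction p with
  | nil => rfl
  | @cons u v w hadj p ih =>
    have hu : IsOneHole u.1 := ⟨u.2.1, u.2.2⟩
    have hv : IsOneHole v.1 := ⟨v.2.1, v.2.2⟩
    have hB : hopMatrix G u.1 v.1 ≠ 0 := by
      rw [holeHopGraph, SimpleGraph.fromRel_adj] at hadj
      have hhop : IsHoleHop G u.1 v.1 := by
        rcases hadj.2 with h | h
        · exact h
        · exact (isOneHole_and_isHoleHop_symm G hΛ ⟨hv, h⟩).2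
      unfold hopMatrix
      rw [if_pos ⟨hu, hhop⟩]
      exact one_ne_zero
    have h1 := hratio _ _ hB
    have hv0 : (liftWeight g v.1 : ℂ) ≠ 0 := by exact_mod_cast (liftWeight_pos hg hΛ v.1).ne'
    have key : (f u.1 * liftWeight g w.1 - f w.1 * liftWeight g u.1) * liftWeight g v.1 = 0 := by
      linear_combination (liftWeight g w.1 : ℂ) * h1 + (liftWeight g u.1 : ℂ) * ih
    rcases mul_eq_zero.1 key with h | h
    · exact sub_eq_zero.1 h
    · exact absurd h hv0

end Spectral

/-! ### The theorem -/

section Main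

/-- **Nagaoka–Tasaki theorem, main form.** For `t < 0` in the tree's convention
`H = -t Σ c†c` (i.e. Tasaki's `t_{xy} = -t ≥ 0`), on a finite lattice with `|Λ| ≥ 2` satisfying the
connectivity condition, with `N = |Λ| - 1` electrons and `U = ∞`: every projected-sector ground
state has total spin `S = N/2`, and the ground space has dimension exactly `N + 1`.
[cite: Tasaki1989, Theorem]; [cite: Tasaki1998, §6.3, Theorem 6.3]. -/
theorem nagaoka_tasaki_of_neg {Λ : Type*} [LinearOrder Λ] [Fintype Λ] (G : SimpleGraph Λ)
    [DecidableRel G.Adj] (hcard : 2 ≤ Fintype.card Λ) (hconn : SatisfiesConnectivity G) {t : ℝ}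
    (ht : t < 0) :
    (∀ ψ : Fock (Orb Λ), IsGutzwillerGroundState (hubbardInfty G t) (Fintype.card Λ - 1) ψ →
        spinSq *ᵥ ψ = ((((Fintype.card Λ - 1 : ℕ) : ℝ) / 2) *
          ((((Fintype.card Λ - 1 : ℕ) : ℝ) / 2) + 1) : ℝ) • ψ) ∧
      Module.finrank ℂ (gutzwillerGroundSpace (hubbardInfty G t) (Fintype.card Λ - 1)) =
        (Fintype.card Λ - 1) + 1 := by
  set N := Fintype.card Λ - 1 with hN
  have hΛ : 0 < Fintype.card Λ := by omega
  haveI : Nonempty Λ := Fintype.card_pos_iff.1 hΛ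
  obtain ⟨lam, g, hlam, hg, heig⟩ := exists_pos_adj_eigenvector G
    (preconnected_of_satisfiesConnectivity G hΛ hconn) (exists_adj_of_satisfiesConnectivity G hcard hconn)
  set H := hubbardInfty G t with hH
  set E : ℝ := t * lam with hEdef
  set Ψ : ℕ → Fock (Orb Λ) := fun k => dicke (fun x => (g x : ℂ)) k with hΨdef
  have hΨeig : ∀ k, H *ᵥ Ψ k = (E : ℂ) • Ψ k := fun k => hubbardInfty_mulVec_dicke G heig hΛ t k
  -- representatives of the `S^z` sectors
  obtain ⟨x₀⟩ := (inferInstance : Nonempty Λ)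
  have hrep : ∀ k, k ≤ N → ∃ s : Finset (Orb Λ), IsOneHole s ∧ holes s = {x₀} ∧ downCount s = k :=
    fun k hk => exists_isOneHole_downCount_eq x₀ hk
  choose! rep hrep1 hrep2 hrep3 using hrep
  have hg0 : (g x₀ : ℂ) ≠ 0 := by exact_mod_cast (hg x₀).ne'
  have hΨrep : ∀ k, k ≤ N → Ψ k (rep k) = gauge (rep k) * g x₀ := by
    intro k hk
    show dicke _ k (rep k) = _
    rw [dicke_apply_of ⟨hrep1 k hk, hrep3 k hk⟩, hrep2 k hk, sum_singleton]
  have hΨne : ∀ k, k ≤ N → Ψ k ≠ 0 := fun k hk h => by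
    have := congrFun h (rep k)
    rw [hΨrep k hk, Pi.zero_apply] at this
    exact mul_ne_zero (gauge_ne_zero _) hg0 this
  have hnorm_pos : ∀ ψ : Fock (Orb Λ), ψ ≠ 0 → 0 < ∑ s, Complex.normSq (ψ s) := by
    intro ψ hψ
    obtain ⟨s, hs⟩ : ∃ s, ψ s ≠ 0 := by
      by_contra h
      push Not at h
      exact hψ (funext h)
    exact lt_of_lt_of_le (Complex.normSq_pos.2 hs)
      (Finset.single_le_sum (fun s _ => Complex.normSq_nonneg _) (mem_univ s))
  -- the ground-state energy is `E = tλ`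
  have hE : gutzwillerGroundEnergy H N = E := by
    apply IsLeast.csInf_eq
    constructor
    · have h0 := hΨne 0 (Nat.zero_le _)
      set c := ∑ s, Complex.normSq (Ψ 0 s) with hcdef
      have hc : 0 < c := hnorm_pos _ h0
      set r : ℝ := (Real.sqrt c)⁻¹ with hrdef
      have hr2 : r ^ 2 * c = 1 := by
        rw [hrdef, inv_pow, Real.sq_sqrt hc.le, inv_mul_cancel₀ hc.ne']
      have hsr : star (r : ℂ) = (r : ℂ) := Complex.conj_ofReal r
      refine ⟨(r : ℂ) • Ψ 0, ?_, ?_, ?_, ?_⟩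
      · intro s hs
        exact mul_eq_zero_of_right _ (isNParticle_dicke (fun x => (g x : ℂ)) 0 s hs)
      · intro s hs
        exact mul_eq_zero_of_right _ (isGutzwiller_dicke (fun x => (g x : ℂ)) 0 s hs)
      · rw [star_smul, smul_dotProduct, dotProduct_smul, star_dotProduct_self_eq, smul_eq_mul,
          smul_eq_mul, hsr, ← hcdef]
        exact_mod_cast (show r * (r * c) = 1 by rw [← hr2]; ring)
      · unfold expect
        rw [mulVec_smul, hΨeig 0, star_smul, smul_dotProduct, dotProduct_smul, dotProduct_smul,
          star_dotProduct_self_eq, ← hcdef]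
        simp only [smul_eq_mul, hsr]
        have e : ((r : ℂ) * ((r : ℂ) * ((E : ℂ) * (c : ℂ)))) = ((r * (r * (E * c)) : ℝ) : ℂ) := by
          push_cast
          ring
        rw [e, Complex.ofReal_re]
        rw [show r * (r * (E * c)) = E * (r ^ 2 * c) by ring, hr2, mul_one]
    · rintro E' ⟨ψ, hNψ, hGψ, hnorm, rfl⟩
      have h1 := mul_norm_le_expect_re G heig hlam hg hΛ ht hNψ hGψ
      have h2 : ∑ s, Complex.normSq (ψ s) = 1 := by
        have := star_dotProduct_self_eq ψ
        rw [hnorm] at this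
        exact_mod_cast this.symm
      rw [h2, mul_one] at h1
      exact h1
  have hGS : ∀ ψ, IsGutzwillerGroundState H N ψ ↔
      IsNParticle N ψ ∧ IsGutzwiller ψ ∧ ψ ≠ 0 ∧ H *ᵥ ψ = (E : ℂ) • ψ := by
    intro ψ
    rw [IsGutzwillerGroundState, hE]
  -- every ground state lies in the span of `Ψ 0, …, Ψ N`
  set Ψ' : Fin (N + 1) → Fock (Orb Λ) := fun k => Ψ k.val with hΨ'def
  have hspan : ∀ ψ, IsGutzwillerGroundState H N ψ → ψ ∈ Submodule.span ℂ (Set.range Ψ') := by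
    intro ψ hψ
    obtain ⟨hNψ, hGψ, -, heq⟩ := (hGS ψ).1 hψ
    have hratio := ratio_of_eigenvector G heig hlam hg hΛ ht hNψ hGψ heq
    rw [Submodule.mem_span_range_iff_exists_fun]
    refine ⟨fun k => gauge (rep k) * ψ (rep k) / g x₀, funext fun s => ?_⟩
    rw [Finset.sum_apply]
    simp only [Pi.smul_apply, smul_eq_mul]
    by_cases hs : IsOneHole s
    · obtain ⟨h, hh⟩ := hs.exists_holes_eq hΛ
      have hk : downCount s ≤ N := downCount_le hs
      rw [Finset.sum_eq_single ⟨downCount s, Nat.lt_succ_of_le hk⟩]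
      · show _ * dicke _ (downCount s) s = ψ s
        rw [dicke_apply_of ⟨hs, rfl⟩, hh, sum_singleton]
        have hup : upCount s = upCount (rep (downCount s)) := by
          have h1 := upCount_add_downCount hs.2
          have h2 := upCount_add_downCount (hrep1 _ hk).2
          rw [hs.1] at h1
          rw [(hrep1 _ hk).1, hrep3 _ hk] at h2
          omega
        obtain ⟨p⟩ := hconn ⟨s, hs.1, hs.2⟩ ⟨rep (downCount s), (hrep1 _ hk).1, (hrep1 _ hk).2⟩ hup
        have hr := ratio_of_walk G hg hΛ hratio p
        simp only at hr
        rw [liftWeight_eq (hrep1 _ hk) (hrep2 _ hk), liftWeight_eq hs hh] at hr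
        have hgs := gauge_mul_self s
        field_simp
        linear_combination (-(gauge s)) * hr + (ψ s * g x₀) * hgs
      · intro k _ hk'
        show _ * dicke _ k.val s = 0
        rw [dicke_apply_of_not, mul_zero]
        rintro ⟨-, h2⟩
        exact hk' (Fin.ext h2.symm)
      · intro h'
        exact absurd (mem_univ _) h'
    · have hψs : ψ s = 0 := by
        by_cases hd : HasDoubleOccupancy s
        · exact hGψ s hd
        · exact hNψ s fun hc => hs ⟨hc, hd⟩
      rw [hψs]
      refine Finset.sum_eq_zero fun k _ => ?_
      show _ * dicke _ k.val s = 0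
      rw [dicke_apply_of_not fun h => hs h.1, mul_zero]
  constructor
  · -- (i) total spin
    intro ψ hψ
    obtain ⟨α, rfl⟩ := (Submodule.mem_span_range_iff_exists_fun ℂ).1 (hspan ψ hψ)
    have hμ : ∀ k, spinSq *ᵥ Ψ' k = ((((N : ℕ) : ℂ) / 2) * ((((N : ℕ) : ℂ) / 2) + 1)) • Ψ' k :=
      fun k => spinSq_mulVec_dicke _ _
    have hsmul : ∀ v : Fock (Orb Λ), ((((N : ℕ) : ℝ) / 2 * ((((N : ℕ) : ℝ) / 2) + 1) : ℝ)) • v =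
        ((((N : ℕ) : ℂ) / 2) * ((((N : ℕ) : ℂ) / 2) + 1)) • v := fun v => by
      funext s
      rw [Pi.smul_apply, Pi.smul_apply, Complex.real_smul, smul_eq_mul]
      push_cast
      rfl
    rw [hsmul, Matrix.mulVec_sum, Finset.smul_sum]
    refine Finset.sum_congr rfl fun k _ => ?_
    rw [mulVec_smul, hμ, smul_comm]
  · -- (ii) dimension of the ground space
    have hspan_eq : gutzwillerGroundSpace H N = Submodule.span ℂ (Set.range Ψ') := by
      apply le_antisymm
      · exact Submodule.span_le.2 fun ψ hψ => hspan ψ hψ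
      · refine Submodule.span_mono ?_
        rintro _ ⟨k, rfl⟩
        exact (hGS _).2 ⟨isNParticle_dicke _ _, isGutzwiller_dicke _ _,
          hΨne k (Nat.le_of_lt_succ k.2), hΨeig k⟩
    rw [hspan_eq, finrank_span_eq_card, Fintype.card_fin]
    rw [Fintype.linearIndependent_iff]
    intro c hc k
    have hk := Nat.le_of_lt_succ k.2
    have := congrFun hc (rep k)
    rw [Finset.sum_apply, Pi.zero_apply, Finset.sum_eq_single k] at this
    · rw [Pi.smul_apply, smul_eq_mul, show Ψ' k (rep k) = _ from hΨrep k hk] at this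
      exact (mul_eq_zero.1 this).resolve_right (mul_ne_zero (gauge_ne_zero _) hg0)
    · intro j _ hj
      rw [Pi.smul_apply, smul_eq_mul, show Ψ' j (rep k) = 0 from dicke_apply_of_not ?_, mul_zero]
      rintro ⟨-, h2⟩
      rw [hrep3 k hk] at h2
      exact hj (Fin.ext h2).symm
    · intro h'
      exact absurd (mem_univ _) h'

end Main

end NagaokaTasaki

section CorrectedFact

/-- **Nagaoka–Tasaki theorem (corrected sign).** The original statement (cite item `wi-03677`;
the proposition negated by `not_nagaoka_tasaki` below) with the hypothesis `0 < t` replaced by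
`t < 0`.

Why: the tree's `hamiltonian G t U` is `-t Σ_{⟨x,y⟩,σ} c†_{xσ} c_{yσ} + U Σ n n`, whereas Tasaki
writes `H_hop = + Σ_{x,y,σ} t_{xy} c†_{xσ} c_{yσ}` (Tasaki 1998, eq. (2.2); no minus sign) and proves
Nagaoka's theorem under `t_{xy} ≥ 0` — "opposite from the standard choice" (Tasaki 1998, footnote
to Theorem 6.3; Tasaki 1989, Theorem). So Tasaki's `t_{xy}` is the tree's `-t`, and the theorem
needs `t ≤ 0` (`t < 0` for the hops to be present); for `t > 0` it fails on non-bipartite graphs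
(`not_nagaoka_tasaki` below: the triangle). On bipartite graphs both signs are equivalent by the
gauge transformation `c_{xσ} → -c_{xσ}` on one sublattice. [cite: Tasaki1989, Theorem] -/
def nagaoka_tasaki_neg : Prop :=
  ∀ (Λ : Type) [LinearOrder Λ] [Fintype Λ] (G : SimpleGraph Λ) [DecidableRel G.Adj],
    2 ≤ Fintype.card Λ → SatisfiesConnectivity G → ∀ t : ℝ, t < 0 →
      let N := Fintype.card Λ - 1
      (∀ ψ : Fock (Orb Λ), IsGutzwillerGroundState (hubbardInfty G t) N ψ →
          spinSq *ᵥ ψ = (((N : ℝ) / 2) * ((N : ℝ) / 2 + 1) : ℝ) • ψ) ∧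
        Module.finrank ℂ (gutzwillerGroundSpace (hubbardInfty G t) N) = N + 1

/-- Discharge of `nagaoka_tasaki_neg`. [cite: Tasaki1989, Theorem] -/
theorem nagaoka_tasaki_neg_holds : nagaoka_tasaki_neg := by
  intro Λ _ _ G _ hcard hconn t ht
  exact NagaokaTasaki.nagaoka_tasaki_of_neg G hcard hconn ht

end CorrectedFact

/-! ## Refutation of the original statement: the triangle

For `t > 0` (the hypothesis of the original statement) the one-hole `U = ∞` model on the triangle `K₃`
has a unique, spin-singlet ground state. -/

namespace NagaokaTasaki

section SchurBound

variable {S : Type*} [Fintype S]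

/-- Schur test, real form: a symmetric entrywise nonnegative matrix with row sums `≤ d` has
quadratic form `≥ -d ‖a‖²`. [folklore] -/
theorem neg_mul_le_quadratic_of_rowsum_le (B : S → S → ℝ) (hB0 : ∀ s s', 0 ≤ B s s')
    (hBs : ∀ s s', B s s' = B s' s) (d : ℝ) (hrow : ∀ s, ∑ s', B s s' ≤ d) (a : S → ℝ) :
    -(d * ∑ s, a s ^ 2) ≤ ∑ s, ∑ s', B s s' * (a s * a s') := by
  have h1 : ∀ s s', -(B s s' * (a s ^ 2 + a s' ^ 2) / 2) ≤ B s s' * (a s * a s') := by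
    intro s s'
    have := hB0 s s'
    nlinarith [sq_nonneg (a s + a s'), mul_nonneg this (sq_nonneg (a s + a s'))]
  have h2 : ∑ s, ∑ s', -(B s s' * (a s ^ 2 + a s' ^ 2) / 2) =
      -∑ s, a s ^ 2 * ∑ s', B s s' := by
    have e : ∀ s s', -(B s s' * (a s ^ 2 + a s' ^ 2) / 2) =
        -(B s s' * a s ^ 2 / 2) + -(B s s' * a s' ^ 2 / 2) := fun s s' => by ring
    simp only [e, Finset.sum_add_distrib]
    have hX : ∑ s, ∑ s', -(B s s' * a s ^ 2 / 2) = -((∑ s, a s ^ 2 * ∑ s', B s s') / 2) := by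
      rw [Finset.sum_div, ← Finset.sum_neg_distrib]
      refine Finset.sum_congr rfl fun s _ => ?_
      rw [Finset.mul_sum, Finset.sum_div, ← Finset.sum_neg_distrib]
      exact Finset.sum_congr rfl fun s' _ => by ring
    have hY : ∑ s, ∑ s', -(B s s' * a s' ^ 2 / 2) = -((∑ s, a s ^ 2 * ∑ s', B s s') / 2) := by
      rw [Finset.sum_comm, Finset.sum_div, ← Finset.sum_neg_distrib]
      refine Finset.sum_congr rfl fun s _ => ?_
      rw [Finset.mul_sum, Finset.sum_div, ← Finset.sum_neg_distrib]
      exact Finset.sum_congr rfl fun s' _ => by rw [hBs s' s]; ring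
    rw [hX, hY]
    ring
  have h3 : ∑ s, a s ^ 2 * ∑ s', B s s' ≤ d * ∑ s, a s ^ 2 := by
    rw [Finset.mul_sum]
    refine Finset.sum_le_sum fun s _ => ?_
    have := mul_le_mul_of_nonneg_left (hrow s) (sq_nonneg (a s))
    linarith
  calc -(d * ∑ s, a s ^ 2) ≤ -∑ s, a s ^ 2 * ∑ s', B s s' := by linarith
    _ = ∑ s, ∑ s', -(B s s' * (a s ^ 2 + a s' ^ 2) / 2) := h2.symm
    _ ≤ ∑ s, ∑ s', B s s' * (a s * a s') :=
        Finset.sum_le_sum fun s _ => Finset.sum_le_sum fun s' _ => h1 s s'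

/-- Schur test, complex form: `Re ⟨f, B f⟩ ≥ -d Σ |f|²` for a symmetric entrywise nonnegative
matrix with row sums `≤ d`. [folklore] -/
theorem neg_mul_le_re_quadratic_of_rowsum_le (B : S → S → ℝ) (hB0 : ∀ s s', 0 ≤ B s s')
    (hBs : ∀ s s', B s s' = B s' s) (d : ℝ) (hrow : ∀ s, ∑ s', B s s' ≤ d) (f : S → ℂ) :
    -(d * ∑ s, Complex.normSq (f s)) ≤
      (∑ s, ∑ s', (B s s' : ℂ) * (starRingEnd ℂ (f s) * f s')).re := by
  set a : S → ℝ := fun s => (f s).re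
  set b : S → ℝ := fun s => (f s).im
  have hre : (∑ s, ∑ s', (B s s' : ℂ) * (starRingEnd ℂ (f s) * f s')).re =
      ∑ s, ∑ s', B s s' * (a s * a s') + ∑ s, ∑ s', B s s' * (b s * b s') := by
    rw [Complex.re_sum, ← Finset.sum_add_distrib]
    refine Finset.sum_congr rfl fun s _ => ?_
    rw [Complex.re_sum, ← Finset.sum_add_distrib]
    refine Finset.sum_congr rfl fun s' _ => ?_
    simp only [Complex.mul_re, Complex.ofReal_re, Complex.ofReal_im, Complex.conj_re,
      Complex.conj_im, zero_mul, sub_zero, a, b]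
    ring
  have hnsq : ∑ s, Complex.normSq (f s) = ∑ s, a s ^ 2 + ∑ s, b s ^ 2 := by
    rw [← Finset.sum_add_distrib]
    refine Finset.sum_congr rfl fun s _ => ?_
    rw [Complex.normSq_apply]
    ring
  rw [hre, hnsq, mul_add, neg_add]
  exact add_le_add (neg_mul_le_quadratic_of_rowsum_le B hB0 hBs d hrow a)
    (neg_mul_le_quadratic_of_rowsum_le B hB0 hBs d hrow b)

end SchurBound

section CompleteGraph

variable {Λ : Type*} [LinearOrder Λ] [Fintype Λ]

/-- On the complete graph the hop matrix has row sums `≤ |Λ| - 1` (the degree of the hole).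
[folklore] -/
theorem sum_hopMatrix_top_le (hΛ : 0 < Fintype.card Λ) (s : Finset (Orb Λ)) :
    ∑ s', hopMatrix (⊤ : SimpleGraph Λ) s s' ≤ ((Fintype.card Λ - 1 : ℕ) : ℝ) := by
  by_cases hs : IsOneHole s
  · obtain ⟨h, hh⟩ := hs.exists_holes_eq hΛ
    have e1 : ∀ s', hopMatrix (⊤ : SimpleGraph Λ) s s' =
        if IsHoleHop (⊤ : SimpleGraph Λ) s s' then (1 : ℝ) else 0 := fun s' => by
      unfold hopMatrix
      by_cases h' : IsHoleHop (⊤ : SimpleGraph Λ) s s'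
      · rw [if_pos ⟨hs, h'⟩, if_pos h']
      · rw [if_neg fun h'' => h' h''.2, if_neg h']
    rw [Finset.sum_congr rfl fun s' _ => e1 s', sum_isHoleHop_eq ⊤ hs.2 hh, Finset.sum_const,
      nsmul_eq_mul, mul_one]
    have : (univ.filter ((⊤ : SimpleGraph Λ).Adj h ·)) = univ.erase h := by
      ext y
      simp [eq_comm]
    rw [this, Finset.card_erase_of_mem (mem_univ h), Finset.card_univ]
  · have e : ∀ s', hopMatrix (⊤ : SimpleGraph Λ) s s' = 0 := fun s' => if_neg fun h => hs h.1
    simp only [e, Finset.sum_const_zero]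
    positivity

/-- **Lower bound on the triangle-type models.** For `t = 1` on the complete graph,
`Re ⟨ψ, Hψ⟩ ≥ -(|Λ| - 1) ‖ψ‖²` on the one-hole Gutzwiller sector. [folklore] -/
theorem neg_norm_le_expect_top {ψ : Fock (Orb Λ)} (hN : IsNParticle (Fintype.card Λ - 1) ψ)
    (hG : IsGutzwiller ψ) (hΛ : 0 < Fintype.card Λ) :
    -(((Fintype.card Λ - 1 : ℕ) : ℝ) * ∑ s, Complex.normSq (ψ s)) ≤
      (expect (hubbardInfty (⊤ : SimpleGraph Λ) 1) ψ).re := by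
  rw [expect_hubbardInfty ⊤ 1 hN hG hΛ, Complex.ofReal_one, one_mul]
  have := neg_mul_le_re_quadratic_of_rowsum_le (hopMatrix (⊤ : SimpleGraph Λ))
    (hopMatrix_nonneg ⊤) (hopMatrix_symm ⊤ hΛ) _ (sum_hopMatrix_top_le hΛ) (fun s => gauge s * ψ s)
  simp only [normSq_gauge_mul] at this
  exact this

end CompleteGraph

/-! ### Decidability of the connectivity condition (for small explicit lattices) -/

section Decidable

variable {Λ : Type*} [LinearOrder Λ] [Fintype Λ]

/-- One-hole configurations have decidable equality. [folklore] -/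
instance instDecidableEqOneHoleConfig : DecidableEq (OneHoleConfig Λ) := by
  unfold OneHoleConfig
  infer_instance

/-- One-hole configurations form a finite type. [folklore] -/
instance instFintypeOneHoleConfig : Fintype (OneHoleConfig Λ) := by
  unfold OneHoleConfig
  infer_instance

/-- Adjacency in the hole-hop graph is decidable. [folklore] -/
instance instDecidableRelHoleHopGraphAdj (G : SimpleGraph Λ) [DecidableRel G.Adj] :
    DecidableRel (holeHopGraph G).Adj := fun a b =>
  decidable_of_iff (a ≠ b ∧ (IsHoleHop G a.1 b.1 ∨ IsHoleHop G b.1 a.1))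
    (by rw [holeHopGraph, SimpleGraph.fromRel_adj])

end Decidable

/-! ### The triangle `K₃` -/

section Triangle

/-- The triangle satisfies Tasaki's connectivity condition (checked by `decide`: each `S^z` sector
of one-hole configurations is a cycle). [cite: Tasaki1998, §6.3 (the triangular lattice satisfies
the connectivity condition)] -/
theorem satisfiesConnectivity_top_fin_three : SatisfiesConnectivity (⊤ : SimpleGraph (Fin 3)) := by
  unfold SatisfiesConnectivity
  decide

/-- `E₁`: hole `0`, `↑` at `1`, `↓` at `2` (even permutation, gauge `+1`). [folklore] -/
def cE1 : Finset (Orb (Fin 3)) := {orb 1 0, orb 2 1}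
/-- `E₂`: hole `1`, `↑` at `2`, `↓` at `0` (even permutation, gauge `-1`). [folklore] -/
def cE2 : Finset (Orb (Fin 3)) := {orb 2 0, orb 0 1}
/-- `E₃`: hole `2`, `↑` at `0`, `↓` at `1` (even permutation, gauge `+1`). [folklore] -/
def cE3 : Finset (Orb (Fin 3)) := {orb 0 0, orb 1 1}
/-- `O₁`: hole `0`, `↑` at `2`, `↓` at `1` (odd permutation, gauge `+1`). [folklore] -/
def cO1 : Finset (Orb (Fin 3)) := {orb 2 0, orb 1 1}
/-- `O₂`: hole `1`, `↑` at `0`, `↓` at `2` (odd permutation, gauge `-1`). [folklore] -/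
def cO2 : Finset (Orb (Fin 3)) := {orb 0 0, orb 2 1}
/-- `O₃`: hole `2`, `↑` at `1`, `↓` at `0` (odd permutation, gauge `+1`). [folklore] -/
def cO3 : Finset (Orb (Fin 3)) := {orb 1 0, orb 0 1}

/-- Configurations where the singlet amplitude is `+1` (`gauge × sign` of the permutation
`(hole, ↑-site, ↓-site)`). [folklore] -/
def posConfigs : Finset (Finset (Orb (Fin 3))) := {cE1, cE3, cO2}

/-- Configurations where the singlet amplitude is `-1`. [folklore] -/
def negConfigs : Finset (Finset (Orb (Fin 3))) := {cE2, cO1, cO3}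

/-- **The singlet ground state of the one-hole `U = ∞` triangle for `t > 0`**: in the gauged basis,
the alternating vector on the 6-cycle formed by the `S^z = 0` sector of the hole-hop graph (the sign
of the permutation `(hole, ↑-site, ↓-site)`). [folklore] -/
def singlet : Fock (Orb (Fin 3)) := fun s =>
  if s ∈ posConfigs then 1 else if s ∈ negConfigs then -1 else 0

/-- Value `+1` of the singlet. [folklore] -/
theorem singlet_of_mem_pos {s : Finset (Orb (Fin 3))} (h : s ∈ posConfigs) : singlet s = 1 :=
  if_pos h

/-- Value `-1` of the singlet. [folklore] -/
theorem singlet_of_mem_neg {s : Finset (Orb (Fin 3))} (h₁ : s ∉ posConfigs)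
    (h₂ : s ∈ negConfigs) : singlet s = -1 := by
  unfold singlet
  rw [if_neg h₁, if_pos h₂]

/-- Value `0` of the singlet. [folklore] -/
theorem singlet_of_not_mem {s : Finset (Orb (Fin 3))} (h₁ : s ∉ posConfigs)
    (h₂ : s ∉ negConfigs) : singlet s = 0 := by
  unfold singlet
  rw [if_neg h₁, if_neg h₂]

/-- The support of the singlet consists of one-hole configurations with one down spin.
[folklore] -/
theorem support_singlet : ∀ s : Finset (Orb (Fin 3)), s ∈ posConfigs ∨ s ∈ negConfigs →
    IsOneHole s ∧ downCount s = 1 := by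
  decide

/-- The `S^z = 0` sector of one-hole configurations of the triangle is `posConfigs ∪ negConfigs`.
[folklore] -/
theorem mem_pos_or_neg_of_isOneHole : ∀ s : Finset (Orb (Fin 3)), IsOneHole s →
    downCount s = 1 → s ∈ posConfigs ∨ s ∈ negConfigs := by
  decide

/-- The singlet vanishes off the `S^z = 0` one-hole sector. [folklore] -/
theorem singlet_eq_zero_of {s : Finset (Orb (Fin 3))} (h : ¬ (IsOneHole s ∧ downCount s = 1)) :
    singlet s = 0 := by
  by_cases h₁ : s ∈ posConfigs
  · exact absurd (support_singlet s (Or.inl h₁)) h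
  · by_cases h₂ : s ∈ negConfigs
    · exact absurd (support_singlet s (Or.inr h₂)) h
    · exact singlet_of_not_mem h₁ h₂

/-- The singlet is a two-electron state. [folklore] -/
theorem isNParticle_singlet : IsNParticle 2 singlet := fun _ hs =>
  singlet_eq_zero_of fun h => hs (by have := h.1.1; simpa using this)

/-- The singlet is a Gutzwiller state. [folklore] -/
theorem isGutzwiller_singlet : IsGutzwiller singlet := fun _ hs =>
  singlet_eq_zero_of fun h => h.1.2 hs

/-- The singlet is nonzero. [folklore] -/
theorem singlet_ne_zero : singlet ≠ 0 := fun h => by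
  have := congrFun h cE1
  rw [singlet_of_mem_pos (by decide), Pi.zero_apply] at this
  exact one_ne_zero this

/-- One row of the eigenvalue equation: the hole of `s` is `h`, its two neighbours in the hole-hop
graph are `s₁, s₂` with holes `h₁, h₂`. [folklore] -/
theorem hop_row {s s₁ s₂ : Finset (Orb (Fin 3))} {h h₁ h₂ a b : Fin 3} (hh : holes s = {h})
    (hab : univ.erase h = {a, b}) (hne : a ≠ b) (h1 : move s a h = s₁) (h2 : move s b h = s₂)
    (hh₁ : holes s₁ = {h₁}) (hh₂ : holes s₂ = {h₂}) :
    gauge s * ∑ y ∈ univ.erase h, gauge (move s y h) * singlet (move s y h) =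
      (-1) ^ nuLeft s h * ((-1) ^ nuLeft s₁ h₁ * singlet s₁ + (-1) ^ nuLeft s₂ h₂ * singlet s₂) := by
  rw [gauge_eq_of_holes_eq hh, hab, Finset.sum_pair hne, h1, h2, gauge_eq_of_holes_eq hh₁,
    gauge_eq_of_holes_eq hh₂]

/-- **The singlet is an eigenvector of the `t = 1` triangle with eigenvalue `-2`.** [folklore] -/
theorem hubbardInfty_mulVec_singlet :
    hubbardInfty (⊤ : SimpleGraph (Fin 3)) 1 *ᵥ singlet = (-2 : ℂ) • singlet := by
  funext s
  rw [Pi.smul_apply, smul_eq_mul]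
  by_cases hs : IsOneHole s
  swap
  · rw [hubbardInfty_mulVec_of_not_isOneHole ⊤ 1 (by simpa using isNParticle_singlet)
      isGutzwiller_singlet hs, singlet_eq_zero_of fun h => hs h.1, mul_zero]
  obtain ⟨h, hh⟩ := hs.exists_holes_eq (by simp)
  rw [hubbardInfty_mulVec_of_holes_eq ⊤ 1 isGutzwiller_singlet hs.2 hh, Complex.ofReal_one, one_mul]
  have hfilter : (univ.filter ((⊤ : SimpleGraph (Fin 3)).Adj h ·)) = univ.erase h := by
    ext y
    simp [eq_comm]
  rw [hfilter]
  by_cases hd : downCount s = 1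
  swap
  · -- outside the `S^z = 0` sector everything vanishes
    rw [singlet_eq_zero_of fun h' => hd h'.2, mul_zero, Finset.sum_eq_zero, mul_zero]
    intro y hy
    have hy' : y ≠ h := Finset.ne_of_mem_erase hy
    rw [singlet_eq_zero_of, mul_zero]
    rintro ⟨-, h2⟩
    rw [downCount_move hs.2 hh hy'] at h2
    exact hd h2
  -- the six configurations of the `S^z = 0` sector, one by one
  have hhole : ∀ {x : Fin 3}, x ∈ holes s → h = x := fun hx => by
    rw [hh, mem_singleton] at hx
    exact hx.symm
  rcases mem_pos_or_neg_of_isOneHole s hs hd with hP | hM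
  · rw [singlet_of_mem_pos hP]
    simp only [posConfigs, Finset.mem_insert, Finset.mem_singleton] at hP
    rcases hP with rfl | rfl | rfl
    · cases hhole (x := 0) (by decide)
      rw [hop_row (s₁ := cO2) (s₂ := cO3) (h₁ := 1) (h₂ := 2) (a := 1) (b := 2) hh (by decide)
        (by decide) (by decide) (by decide) (by decide) (by decide),
        singlet_of_mem_pos (s := cO2) (by decide), singlet_of_mem_neg (s := cO3) (by decide) (by decide),
        show nuLeft cE1 0 = 0 by decide, show nuLeft cO2 1 = 1 by decide, show nuLeft cO3 2 = 2 by decide]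
      norm_num
    · cases hhole (x := 2) (by decide)
      rw [hop_row (s₁ := cO1) (s₂ := cO2) (h₁ := 0) (h₂ := 1) (a := 0) (b := 1) hh (by decide)
        (by decide) (by decide) (by decide) (by decide) (by decide),
        singlet_of_mem_neg (s := cO1) (by decide) (by decide), singlet_of_mem_pos (s := cO2) (by decide),
        show nuLeft cE3 2 = 2 by decide, show nuLeft cO1 0 = 0 by decide, show nuLeft cO2 1 = 1 by decide]
      norm_num
    · cases hhole (x := 1) (by decide)
      rw [hop_row (s₁ := cE1) (s₂ := cE3) (h₁ := 0) (h₂ := 2) (a := 0) (b := 2) hh (by decide)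
        (by decide) (by decide) (by decide) (by decide) (by decide),
        singlet_of_mem_pos (s := cE1) (by decide), singlet_of_mem_pos (s := cE3) (by decide),
        show nuLeft cO2 1 = 1 by decide, show nuLeft cE1 0 = 0 by decide, show nuLeft cE3 2 = 2 by decide]
      norm_num
  · have hP : s ∉ posConfigs := fun hP => by
      have : Disjoint posConfigs negConfigs := by decide
      exact Finset.disjoint_left.1 this hP hM
    rw [singlet_of_mem_neg hP hM]
    simp only [negConfigs, Finset.mem_insert, Finset.mem_singleton] at hM
    rcases hM with rfl | rfl | rfl
    · cases hhole (x := 1) (by decide)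
      rw [hop_row (s₁ := cO1) (s₂ := cO3) (h₁ := 0) (h₂ := 2) (a := 0) (b := 2) hh (by decide)
        (by decide) (by decide) (by decide) (by decide) (by decide),
        singlet_of_mem_neg (s := cO1) (by decide) (by decide),
        singlet_of_mem_neg (s := cO3) (by decide) (by decide),
        show nuLeft cE2 1 = 1 by decide, show nuLeft cO1 0 = 0 by decide, show nuLeft cO3 2 = 2 by decide]
      norm_num
    · cases hhole (x := 0) (by decide)
      rw [hop_row (s₁ := cE2) (s₂ := cE3) (h₁ := 1) (h₂ := 2) (a := 1) (b := 2) hh (by decide)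
        (by decide) (by decide) (by decide) (by decide) (by decide),
        singlet_of_mem_neg (s := cE2) (by decide) (by decide), singlet_of_mem_pos (s := cE3) (by decide),
        show nuLeft cO1 0 = 0 by decide, show nuLeft cE2 1 = 1 by decide, show nuLeft cE3 2 = 2 by decide]
      norm_num
    · cases hhole (x := 2) (by decide)
      rw [hop_row (s₁ := cE1) (s₂ := cE2) (h₁ := 0) (h₂ := 1) (a := 0) (b := 1) hh (by decide)
        (by decide) (by decide) (by decide) (by decide) (by decide),
        singlet_of_mem_pos (s := cE1) (by decide), singlet_of_mem_neg (s := cE2) (by decide) (by decide),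
        show nuLeft cO3 2 = 2 by decide, show nuLeft cE1 0 = 0 by decide, show nuLeft cE2 1 = 1 by decide]
      norm_num

/-- The ground-state energy of the `t = 1` one-hole triangle is `-2`. [folklore] -/
theorem gutzwillerGroundEnergy_triangle :
    gutzwillerGroundEnergy (hubbardInfty (⊤ : SimpleGraph (Fin 3)) 1) 2 = -2 := by
  apply IsLeast.csInf_eq
  constructor
  · set c := ∑ s, Complex.normSq (singlet s) with hcdef
    have hc : 0 < c := by
      have h1 : Complex.normSq (singlet cE1) = 1 := by rw [singlet_of_mem_pos (by decide)]; simp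
      have := Finset.single_le_sum (f := fun s => Complex.normSq (singlet s))
        (fun s _ => Complex.normSq_nonneg _) (mem_univ cE1)
      simp only [h1] at this
      linarith
    set r : ℝ := (Real.sqrt c)⁻¹ with hrdef
    have hr2 : r ^ 2 * c = 1 := by
      rw [hrdef, inv_pow, Real.sq_sqrt hc.le, inv_mul_cancel₀ hc.ne']
    have hsr : star (r : ℂ) = (r : ℂ) := Complex.conj_ofReal r
    refine ⟨(r : ℂ) • singlet, ?_, ?_, ?_, ?_⟩
    · intro s hs
      exact mul_eq_zero_of_right _ (isNParticle_singlet s hs)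
    · intro s hs
      exact mul_eq_zero_of_right _ (isGutzwiller_singlet s hs)
    · rw [star_smul, smul_dotProduct, dotProduct_smul, star_dotProduct_self_eq, smul_eq_mul,
        smul_eq_mul, hsr, ← hcdef]
      exact_mod_cast (show r * (r * c) = 1 by rw [← hr2]; ring)
    · unfold expect
      rw [mulVec_smul, hubbardInfty_mulVec_singlet, star_smul, smul_dotProduct, dotProduct_smul,
        dotProduct_smul, star_dotProduct_self_eq, ← hcdef]
      simp only [smul_eq_mul, hsr]
      have e : ((r : ℂ) * ((r : ℂ) * ((-2 : ℂ) * (c : ℂ)))) = ((r * (r * (-2 * c)) : ℝ) : ℂ) := by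
        push_cast
        ring
      rw [e, Complex.ofReal_re]
      rw [show r * (r * (-2 * c)) = -2 * (r ^ 2 * c) by ring, hr2, mul_one]
  · rintro E' ⟨ψ, hNψ, hGψ, hnorm, rfl⟩
    have h1 := neg_norm_le_expect_top (Λ := Fin 3) (ψ := ψ) (by simpa using hNψ) hGψ (by simp)
    have h2 : ∑ s, Complex.normSq (ψ s) = 1 := by
      have := star_dotProduct_self_eq ψ
      rw [hnorm] at this
      exact_mod_cast this.symm
    rw [h2, mul_one] at h1
    have h3 : ((Fintype.card (Fin 3) - 1 : ℕ) : ℝ) = 2 := by simp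
    rw [h3] at h1
    exact h1

/-- The singlet is a projected-sector ground state of the `t = 1` triangle. [folklore] -/
theorem isGutzwillerGroundState_singlet :
    IsGutzwillerGroundState (hubbardInfty (⊤ : SimpleGraph (Fin 3)) 1) 2 singlet := by
  refine ⟨isNParticle_singlet, isGutzwiller_singlet, singlet_ne_zero, ?_⟩
  rw [gutzwillerGroundEnergy_triangle, hubbardInfty_mulVec_singlet]
  push_cast
  rfl

/-- The polarised configurations with hole `0`: all down. [folklore] -/
def cDD : Finset (Orb (Fin 3)) := {orb 1 1, orb 2 1}
/-- The polarised configurations with hole `0`: all up. [folklore] -/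
def cUU : Finset (Orb (Fin 3)) := {orb 1 0, orb 2 0}

/-- **The singlet is a singlet**: `(S² ψ₀)(E₁) = 0` (whereas `ψ₀(E₁) = 1`). [folklore] -/
theorem spinSq_mulVec_singlet_cE1 : (spinSq *ᵥ singlet) cE1 = 0 := by
  rw [spinSq_mulVec, Pi.add_apply, Pi.smul_apply, Pi.add_apply, spinZ_mulVec_apply,
    show upCount cE1 = 1 by decide, show downCount cE1 = 1 by decide]
  have hE1 : ¬ HasDoubleOccupancy cE1 := by decide
  have hDD : ¬ HasDoubleOccupancy cDD := by decide
  have hUU : ¬ HasDoubleOccupancy cUU := by decide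
  rw [spinPlus_mulVec_apply_of_not_hasDoubleOccupancy _ hE1,
    spinMinus_mulVec_apply_of_not_hasDoubleOccupancy _ hE1, Fin.sum_univ_three, Fin.sum_univ_three,
    if_neg (show orb (0 : Fin 3) (0 : Fin 2) ∉ cE1 by decide),
    if_pos (show orb (1 : Fin 3) (0 : Fin 2) ∈ cE1 by decide),
    if_neg (show orb (2 : Fin 3) (0 : Fin 2) ∉ cE1 by decide),
    if_neg (show orb (0 : Fin 3) (1 : Fin 2) ∉ cE1 by decide),
    if_neg (show orb (1 : Fin 3) (1 : Fin 2) ∉ cE1 by decide),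
    if_pos (show orb (2 : Fin 3) (1 : Fin 2) ∈ cE1 by decide),
    show insert (orb (1 : Fin 3) (1 : Fin 2)) (cE1.erase (orb 1 0)) = cDD by decide,
    show insert (orb (2 : Fin 3) (0 : Fin 2)) (cE1.erase (orb 2 1)) = cUU by decide,
    spinMinus_mulVec_apply_of_not_hasDoubleOccupancy _ hDD,
    spinPlus_mulVec_apply_of_not_hasDoubleOccupancy _ hUU, Fin.sum_univ_three, Fin.sum_univ_three,
    if_neg (show orb (0 : Fin 3) (1 : Fin 2) ∉ cDD by decide),
    if_pos (show orb (1 : Fin 3) (1 : Fin 2) ∈ cDD by decide),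
    if_pos (show orb (2 : Fin 3) (1 : Fin 2) ∈ cDD by decide),
    if_neg (show orb (0 : Fin 3) (0 : Fin 2) ∉ cUU by decide),
    if_pos (show orb (1 : Fin 3) (0 : Fin 2) ∈ cUU by decide),
    if_pos (show orb (2 : Fin 3) (0 : Fin 2) ∈ cUU by decide),
    show insert (orb (1 : Fin 3) (0 : Fin 2)) (cDD.erase (orb 1 1)) = cE1 by decide,
    show insert (orb (2 : Fin 3) (0 : Fin 2)) (cDD.erase (orb 2 1)) = cO1 by decide,
    show insert (orb (1 : Fin 3) (1 : Fin 2)) (cUU.erase (orb 1 0)) = cO1 by decide,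
    show insert (orb (2 : Fin 3) (1 : Fin 2)) (cUU.erase (orb 2 0)) = cE1 by decide,
    singlet_of_mem_pos (s := cE1) (by decide), singlet_of_mem_neg (s := cO1) (by decide) (by decide)]
  norm_num

end Triangle

end NagaokaTasaki

section Refutation

/-- **The original Nagaoka–Tasaki statement (hypothesis `0 < t`) is false** (wrong sign of `t`;
the negated proposition below is that statement verbatim: Tasaki's connectivity condition,
`|Λ| ≥ 2`, `t > 0`, `N = |Λ| - 1` ⟹ every projected-sector ground state of `hubbardInfty G t` has
`S² ψ = S(S+1) ψ`, `S = N/2`, and the projected ground space has dimension `N + 1`): on the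
triangle `K₃` — which
satisfies the connectivity condition — with `t = 1 > 0` and `N = 2`, the projected-sector ground
state of `hubbardInfty ⊤ 1` is the spin SINGLET `NagaokaTasaki.singlet` (energy `-2`), so
`S² ψ = S(S+1) ψ` with `S = 1` fails. See `nagaoka_tasaki_neg` for the corrected statement.
[cite: Tasaki1998, Theorem 6.3 and its footnote (`t_{xy} ≥ 0`, opposite to the standard sign)] -/
theorem not_nagaoka_tasaki :
    ¬ ∀ (Λ : Type) [LinearOrder Λ] [Fintype Λ] (G : SimpleGraph Λ) [DecidableRel G.Adj],
        2 ≤ Fintype.card Λ → SatisfiesConnectivity G → ∀ t : ℝ, 0 < t →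
          let N := Fintype.card Λ - 1
          (∀ ψ : Fock (Orb Λ), IsGutzwillerGroundState (hubbardInfty G t) N ψ →
              spinSq *ᵥ ψ = (((N : ℝ) / 2) * ((N : ℝ) / 2 + 1) : ℝ) • ψ) ∧
            Module.finrank ℂ (gutzwillerGroundSpace (hubbardInfty G t) N) = N + 1 := by
  intro hNT
  obtain ⟨hspin, -⟩ := hNT (Fin 3) ⊤ (by simp) NagaokaTasaki.satisfiesConnectivity_top_fin_three
    1 one_pos
  have hGS : IsGutzwillerGroundState (hubbardInfty (⊤ : SimpleGraph (Fin 3)) 1)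
      (Fintype.card (Fin 3) - 1) NagaokaTasaki.singlet := by
    rw [show Fintype.card (Fin 3) - 1 = 2 by simp]
    exact NagaokaTasaki.isGutzwillerGroundState_singlet
  have h := congrFun (hspin _ hGS) NagaokaTasaki.cE1
  rw [NagaokaTasaki.spinSq_mulVec_singlet_cE1, Pi.smul_apply,
    NagaokaTasaki.singlet_of_mem_pos (by decide), Complex.real_smul, mul_one] at h
  have h3 : ((Fintype.card (Fin 3) - 1 : ℕ) : ℝ) = 2 := by simp
  rw [h3] at h
  norm_num at h

end Refutation

end Literature.MathematicalPhysics.QuantumLattice
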